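import Literature.Probability.RandomPlanarGeometry.YangBaxterSAWLocalRelations
import HarnessLib

/-!
# Glazman–Manolescu, Lemma 2.1: the grouping argument

Topic `Literature/Probability/RandomPlanarGeometry`; sixth support file for the discharge of
`Literature.Probability.RandomPlanarGeometry.SAW.YangBaxter.GlazmanManolescu2019_thm1`. Source:
A. Glazman, I. Manolescu, arXiv:1708.00395, **Lemma 2.1** (the vertex relation (CR) of the
parafermionic observable, `GlazmanManolescu2019_lem21` of `YangBaxterSAWObservable.lean`), whose
proof is that of [Gl] = A. Glazman, ECP 20 (2015), Lemma 3.1: "consider all paths contributing to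
Eq. (3.2) for a fixed rhombus … divided into several groups such that walks in the same group
differ only inside [the rhombus] … the total contribution of paths in each group is zero".

This file PROVES the grouping half of that proof:
`GlazmanManolescu2019_lem21_of_excursionWinding : GlazmanManolescu2019_excursionWinding →
GlazmanManolescu2019_lem21`, the local relations being those of `YangBaxterSAWLocalRelations.lean`
(`groupOne_*`, `groupTwo_*`, put in general position here: `groupOne_gen`, `groupTwo_gen`) and the
remaining input being the named fact `GlazmanManolescu2019_excursionWinding` (the planar-topology
statement that an excursion of a self-avoiding walk outside a rhombus, between two of its sides,
winds by the tabulated amount `excursionWinding`; used silently in the printed proofs).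

## The argument (`Ω`, `Ω.sum_g_eq_zero`)

Fix a rhombus `r ∈ Rect_{T,L}` of angle `θ`. The relation (CR) says `Σ_ω c(z) w̃(γ) = 0` over the
labelled walks `ω = (z, γ)`, `γ : 0 → r.side z` (`Ω T L r`, a finite type; `Ω.g`; contour
coefficients `c = crCoef θ`). Every such walk crosses `∂r` first at an index `firstHit` (side
`firstSide = z₀`); then (`Ω.isA_or`) either it stops (class `A`), or its next arc lies INSIDE `r`
(`YBWalk.arcFace_firstHit`: the previous arc lies in the other rhombus at that edge) and reaches
the side `z₁ = exitSide`, after which it stops (class `B1`) or makes an excursion outside `r`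
(`YBWalk.arcFace_ne_of_excursion`) back to a third side `z₂ = returnSide` at the index `returnHit`,
where it stops (class `B2a`) or re-enters `r` (`YBWalk.arcFace_returnHit`) to the fourth side and
stops there (class `B2b`; `YBWalk.returnHit_add_one_eq`: a fifth crossing is impossible).
* Classes `A ∪ B1` (`Ω.sum_A_add_sum_B1`): `B1` is in bijection with `A × {z₁ ≠ z₀}` by dropping /
  appending the arc in `r` (`Ω.baseA`, `Ω.extA`; `YBWalk.dropLast`, `YBWalk.snoc`), the weight and
  winding changing by `u(z₀z₁)` and `turn(z₀z₁)` (`Ω.paraWeight_extA`); each fibre sums to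
  `w̃(P) · groupOne = 0`.
* Classes `B2a ∪ B2b` (`Ω.sum_B2a_add_sum_B2b`): `B2b` is in bijection with the walks of `B2a`
  whose arc in `r` is not straight, by dropping / appending the second arc of `r` (`Ω.base₂`,
  `Ω.ext₃`; `Ω.not_straight_of_isB2b`: the two arcs cannot both be straight); folding `B2b` into
  `B2a` (`Ω.T₃`, `Ω.G`) the sum vanishes by `Finset.sum_involution` for the fixed-point-free
  involution `Ω.rev` reversing everything after the first crossing (`YBWalk.revSuffix`: the
  junction arc `z₀ → z₂` replaces `z₀ → z₁`, all other rhombi keep their arcs up to order, so the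
  exterior weight `YBWalk.extWeight` is unchanged, `localWeight_perm`, and the excursion winding
  changes sign): `G ω + G (rev ω) = w_ext · e^{−iσ W(prefix)} · groupTwo = 0` (`Ω.G_add_G_rev`),
  using the excursion winding fact for the value of `W(excursion)`.

Also provided (general walk surgery, used again for the excursion fact): index access
`YBWalk.nth`, the constructor `YBWalk.ofFn`, `YBWalk.take`, `YBWalk.dropLast`, `YBWalk.snoc`,
`YBWalk.revSuffix`, their arcs as lists, and the behaviour of `kindsIn`, `facesVisited`,
`weight` (`YBWalk.weight_eq_extWeight_mul`) and `winding` under them.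
-/
noncomputable section
open scoped ENNReal
open Real

namespace Literature.Probability.RandomPlanarGeometry.SAW.YangBaxter


/-- Two distinct sides of a face have that face as their common face. [folklore] -/
theorem arcFace_side_side (f : Face) (s t : Side) (hst : s ≠ t) : arcFace (f.side s, f.side t) = some f := by
  obtain ⟨k, j⟩ := f
  cases s <;> cases t <;> simp only [ne_eq, not_true_eq_false] at hst <;>
    simp [arcFace, MidEdge.commonFace, Face.side, MidEdge.faces] <;> omega

/-! ### Walks from index functions -/

/-- Membership in `arcsOf` through indices. [folklore] -/
theorem mem_arcsOf_iff {l : List MidEdge} {p : MidEdge × MidEdge} :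
    p ∈ arcsOf l ↔ ∃ (i : ℕ) (hi : i + 1 < l.length), p = (l[i], l[i + 1]) := by
  rw [List.mem_iff_getElem]
  constructor
  · rintro ⟨i, hi, rfl⟩
    have hi' : i + 1 < l.length := by simp [arcsOf, List.length_zip] at hi; omega
    exact ⟨i, hi', by simp [arcsOf, List.getElem_zip, List.getElem_tail]⟩
  · rintro ⟨i, hi, rfl⟩
    refine ⟨i, by simp [arcsOf, List.length_zip]; omega, by simp [arcsOf, List.getElem_zip, List.getElem_tail]⟩

/-- `arcsOf` of `List.ofFn`. [folklore] -/
theorem mem_arcsOf_ofFn_iff {n : ℕ} {v : ℕ → MidEdge} {p : MidEdge × MidEdge} :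
    p ∈ arcsOf (List.ofFn fun i : Fin (n + 1) => v i) ↔ ∃ i < n, p = (v i, v (i + 1)) := by
  rw [mem_arcsOf_iff]
  simp only [List.length_ofFn, List.getElem_ofFn]
  constructor
  · rintro ⟨i, hi, rfl⟩; exact ⟨i, by omega, rfl⟩
  · rintro ⟨i, hi, rfl⟩; exact ⟨i, by omega, rfl⟩

/-- The two straight arcs of a face, as a predicate on ordered pairs. [folklore] -/
def IsWE (f : Face) (p : MidEdge × MidEdge) : Prop := p = (f.side .W, f.side .E) ∨ p = (f.side .E, f.side .W)

/-- The two straight arcs of a face, as a predicate on ordered pairs. [folklore] -/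
def IsSN (f : Face) (p : MidEdge × MidEdge) : Prop := p = (f.side .S, f.side .N) ∨ p = (f.side .N, f.side .S)

namespace YBWalk

variable {D : Set Face} {a z : MidEdge}

/-- **A walk from an index function**: `v 0, …, v n` pairwise distinct, consecutive ones two sides
of a rhombus of the domain, consecutive arcs in different rhombi, no two crossing straight arcs.
[folklore] -/
def ofFn (n : ℕ) (v : ℕ → MidEdge) (hinj : ∀ i j, i ≤ n → j ≤ n → v i = v j → i = j)
    (harc : ∀ i < n, ∃ f ∈ D, arcFace (v i, v (i + 1)) = some f)
    (hchain : ∀ i, i + 1 < n → arcFace (v i, v (i + 1)) ≠ arcFace (v (i + 1), v (i + 2)))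
    (hnc : ∀ i j, i < n → j < n → ∀ f : Face, IsWE f (v i, v (i + 1)) → ¬IsSN f (v j, v (j + 1))) :
    YBWalk D (v 0) (v n) where
  mids := List.ofFn fun i : Fin (n + 1) => v i
  head_eq := by simp [List.head?_eq_getElem?, -List.ofFn_succ]
  getLast_eq := by simp [List.getLast?_eq_getElem?, -List.ofFn_succ]
  nodup := by
    rw [List.nodup_iff_injective_get]
    intro i j h
    simp only [List.get_eq_getElem, List.getElem_ofFn] at h
    exact Fin.ext (hinj _ _ (by have := i.2; simp at this; omega) (by have := j.2; simp at this; omega) h)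
  arc_mem p hp := by
    obtain ⟨i, hi, rfl⟩ := mem_arcsOf_ofFn_iff.1 hp
    exact harc i hi
  isChain := by
    rw [List.isChain_iff_getElem]
    intro i hi
    have hn : i + 1 < n := by simp [arcsOf, List.length_zip] at hi; omega
    have e : ∀ (k : ℕ) (hk : k < (arcsOf (List.ofFn fun i : Fin (n + 1) => v i)).length),
        (arcsOf (List.ofFn fun i : Fin (n + 1) => v i))[k] = (v k, v (k + 1)) := by
      intro k hk
      simp [arcsOf, List.getElem_zip, -List.ofFn_succ]
    rw [e, e]
    exact hchain i hn
  noncross f h1 h2 := by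
    have h1' : ∃ i < n, IsWE f (v i, v (i + 1)) := by
      rcases h1 with h | h
      · obtain ⟨i, hi, e⟩ := mem_arcsOf_ofFn_iff.1 h; exact ⟨i, hi, Or.inl e.symm⟩
      · obtain ⟨i, hi, e⟩ := mem_arcsOf_ofFn_iff.1 h; exact ⟨i, hi, Or.inr e.symm⟩
    have h2' : ∃ j < n, IsSN f (v j, v (j + 1)) := by
      rcases h2 with h | h
      · obtain ⟨i, hi, e⟩ := mem_arcsOf_ofFn_iff.1 h; exact ⟨i, hi, Or.inl e.symm⟩
      · obtain ⟨i, hi, e⟩ := mem_arcsOf_ofFn_iff.1 h; exact ⟨i, hi, Or.inr e.symm⟩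
    obtain ⟨i, hi, hWE⟩ := h1'
    obtain ⟨j, hj, hSN⟩ := h2'
    exact hnc i j hi hj f hWE hSN

/-! #### Index access -/

/-- The `i`-th mid-edge of a walk (junk `a` beyond the end). [folklore] -/
def nth (γ : YBWalk D a z) (i : ℕ) : MidEdge := γ.mids.getD i a

variable (γ : YBWalk D a z)

/-- `nth` is `getElem` inside the range. [folklore] -/
theorem nth_eq_getElem {i : ℕ} (hi : i < γ.mids.length) : γ.nth i = γ.mids[i] := by
  rw [nth, List.getD_eq_getElem?_getD, List.getElem?_eq_getElem hi, Option.getD_some]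

/-- A walk with `n` arcs crosses `n + 1` mid-edges. [folklore] -/
theorem length_eq : γ.mids.length = γ.arcs.length + 1 := by
  have := γ.length_arcs; have := γ.length_pos; omega

/-- The walk starts at `a`. [folklore] -/
@[simp] theorem nth_zero : γ.nth 0 = a := by rw [nth_eq_getElem _ γ.length_pos, γ.getElem_zero]

/-- The walk ends at `z`. [folklore] -/
@[simp] theorem nth_length : γ.nth γ.arcs.length = z := by
  rw [nth_eq_getElem _ (by rw [length_eq]; omega)]
  have h := γ.getElem_length_sub_one
  have e : γ.arcs.length = γ.mids.length - 1 := γ.length_arcs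
  simp only [e]; exact h

/-- The mid-edges of a walk are distinct. [folklore] -/
theorem nth_inj {i j : ℕ} (hi : i ≤ γ.arcs.length) (hj : j ≤ γ.arcs.length) (h : γ.nth i = γ.nth j) : i = j := by
  rw [nth_eq_getElem _ (by rw [length_eq]; omega), nth_eq_getElem _ (by rw [length_eq]; omega)] at h
  exact (γ.nodup.getElem_inj_iff).1 h

/-- `nth i` is a crossed mid-edge. [folklore] -/
theorem nth_mem {i : ℕ} (hi : i ≤ γ.arcs.length) : γ.nth i ∈ γ.mids := by
  rw [nth_eq_getElem _ (by rw [length_eq]; omega)]; exact List.getElem_mem _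

/-- Consecutive mid-edges form an arc of the walk. [folklore] -/
theorem arc_nth_mem {i : ℕ} (hi : i < γ.arcs.length) : (γ.nth i, γ.nth (i + 1)) ∈ γ.arcs := by
  rw [nth_eq_getElem _ (by rw [length_eq]; omega), nth_eq_getElem _ (by rw [length_eq]; omega)]
  exact γ.mk_mem_arcs _

/-- The `i`-th arc through `nth`. [folklore] -/
theorem arcs_getElem_eq_nth {i : ℕ} (hi : i < γ.arcs.length) : γ.arcs[i] = (γ.nth i, γ.nth (i + 1)) := by
  rw [γ.getElem_arcs hi, nth_eq_getElem, nth_eq_getElem]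

/-- Each arc lies in a rhombus of the domain. [folklore] -/
theorem arc_nth {i : ℕ} (hi : i < γ.arcs.length) : ∃ f ∈ D, arcFace (γ.nth i, γ.nth (i + 1)) = some f :=
  γ.arc_mem _ (γ.arc_nth_mem hi)

/-- Consecutive arcs lie in different rhombi. [folklore] -/
theorem chain_nth {i : ℕ} (hi : i + 1 < γ.arcs.length) :
    arcFace (γ.nth i, γ.nth (i + 1)) ≠ arcFace (γ.nth (i + 1), γ.nth (i + 2)) := by
  have := γ.arcFace_ne_succ (i := i) (by rw [length_eq]; omega)
  rwa [← nth_eq_getElem, ← nth_eq_getElem, ← nth_eq_getElem] at this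

/-- No two crossing straight arcs. [folklore] -/
theorem nc_nth {i j : ℕ} (hi : i < γ.arcs.length) (hj : j < γ.arcs.length) (f : Face)
    (hWE : IsWE f (γ.nth i, γ.nth (i + 1))) : ¬IsSN f (γ.nth j, γ.nth (j + 1)) := by
  intro hSN
  have h1 := γ.arc_nth_mem hi
  have h2 := γ.arc_nth_mem hj
  refine γ.noncross f ?_ ?_
  · rcases hWE with e | e <;> rw [e] at h1
    · exact Or.inl h1
    · exact Or.inr h1
  · rcases hSN with e | e <;> rw [e] at h2
    · exact Or.inl h2
    · exact Or.inr h2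

/-- Membership in the mid-edges through `nth`. [folklore] -/
theorem mem_mids_iff_nth {e : MidEdge} : e ∈ γ.mids ↔ ∃ i ≤ γ.arcs.length, γ.nth i = e := by
  rw [List.mem_iff_getElem]
  constructor
  · rintro ⟨i, hi, rfl⟩; exact ⟨i, by rw [length_eq] at hi; omega, γ.nth_eq_getElem hi⟩
  · rintro ⟨i, hi, rfl⟩; exact ⟨i, by rw [length_eq]; omega, (γ.nth_eq_getElem _).symm⟩

/-- Membership in the arcs through `nth`. [folklore] -/
theorem mem_arcs_iff_nth {p : MidEdge × MidEdge} : p ∈ γ.arcs ↔ ∃ i < γ.arcs.length, p = (γ.nth i, γ.nth (i + 1)) := by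
  rw [γ.mem_arcs_iff]
  constructor
  · rintro ⟨i, hi, rfl⟩
    exact ⟨i, by rw [length_eq] at hi; omega, by rw [nth_eq_getElem, nth_eq_getElem]⟩
  · rintro ⟨i, hi, rfl⟩
    exact ⟨i, by rw [length_eq]; omega, by rw [nth_eq_getElem, nth_eq_getElem]⟩

variable {γ}

/-! #### The mid-edges of `ofFn` -/

/-- The mid-edges of `ofFn`. [folklore] -/
theorem ofFn_mids {n : ℕ} {v : ℕ → MidEdge} (hinj harc hchain hnc) :
    (ofFn (D := D) n v hinj harc hchain hnc).mids = List.ofFn fun i : Fin (n + 1) => v i := rfl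

/-- The number of arcs of `ofFn`. [folklore] -/
theorem ofFn_length {n : ℕ} {v : ℕ → MidEdge} (hinj harc hchain hnc) :
    (ofFn (D := D) n v hinj harc hchain hnc).arcs.length = n := by
  rw [length_arcs, ofFn_mids, List.length_ofFn]; omega

/-- `nth` of `ofFn`. [folklore] -/
theorem ofFn_nth {n : ℕ} {v : ℕ → MidEdge} (hinj harc hchain hnc) {i : ℕ} (hi : i ≤ n) :
    (ofFn (D := D) n v hinj harc hchain hnc).nth i = v i := by
  rw [nth_eq_getElem _ (by rw [ofFn_mids, List.length_ofFn]; omega)]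
  simp [ofFn_mids, -List.ofFn_succ]

/-- The arcs of `ofFn`. [folklore] -/
theorem ofFn_mem_arcs {n : ℕ} {v : ℕ → MidEdge} (hinj harc hchain hnc) {p : MidEdge × MidEdge} :
    p ∈ (ofFn (D := D) n v hinj harc hchain hnc).arcs ↔ ∃ i < n, p = (v i, v (i + 1)) :=
  mem_arcsOf_ofFn_iff

/-! #### Transport of the endpoints -/

/-- Transport a walk along equalities of its endpoints. [folklore] -/
def cast (γ : YBWalk D a z) {a' z' : MidEdge} (ha : a = a') (hz : z = z') : YBWalk D a' z' :=
  ha ▸ hz ▸ γ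

/-- Transport does not change the mid-edges. [folklore] -/
@[simp] theorem cast_mids (γ : YBWalk D a z) {a' z' : MidEdge} (ha : a = a') (hz : z = z') :
    (γ.cast ha hz).mids = γ.mids := by subst ha hz; rfl

/-! #### Dropping the last arc -/

/-- **The walk without its last arc.** [folklore] -/
def dropLast (γ : YBWalk D a z) (hn : 0 < γ.arcs.length) : YBWalk D a (γ.nth (γ.arcs.length - 1)) :=
  (ofFn (γ.arcs.length - 1) γ.nth
    (fun i j hi hj h => γ.nth_inj (by omega) (by omega) h)
    (fun i hi => γ.arc_nth (by omega))
    (fun i hi => γ.chain_nth (by omega))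
    (fun i j hi hj f hWE => γ.nc_nth (by omega) (by omega) f hWE)).cast γ.nth_zero rfl

/-- The mid-edges after dropping the last arc. [folklore] -/
theorem dropLast_mids (γ : YBWalk D a z) (hn : 0 < γ.arcs.length) :
    (γ.dropLast hn).mids = List.ofFn fun i : Fin (γ.arcs.length - 1 + 1) => γ.nth i := by
  rw [dropLast, cast_mids]; rfl

/-- Dropping the last arc removes one arc. [folklore] -/
theorem dropLast_length (γ : YBWalk D a z) (hn : 0 < γ.arcs.length) :
    (γ.dropLast hn).arcs.length = γ.arcs.length - 1 := by
  rw [length_arcs, dropLast_mids, List.length_ofFn]; omega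

/-- `nth` after dropping the last arc. [folklore] -/
theorem dropLast_nth (γ : YBWalk D a z) (hn : 0 < γ.arcs.length) {i : ℕ} (hi : i ≤ γ.arcs.length - 1) :
    (γ.dropLast hn).nth i = γ.nth i := by
  rw [nth_eq_getElem _ (by rw [dropLast_mids, List.length_ofFn]; omega)]
  simp [dropLast_mids, -List.ofFn_succ]

/-- The arcs after dropping the last arc. [folklore] -/
theorem dropLast_mem_arcs (γ : YBWalk D a z) (hn : 0 < γ.arcs.length) {p : MidEdge × MidEdge} :
    p ∈ (γ.dropLast hn).arcs ↔ ∃ i < γ.arcs.length - 1, p = (γ.nth i, γ.nth (i + 1)) := by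
  show p ∈ arcsOf (γ.dropLast hn).mids ↔ _
  rw [dropLast_mids]; exact mem_arcsOf_ofFn_iff

/-! #### Appending one arc -/

/-- **The walk extended by one arc** `z → e` in the rhombus `f`, which may already carry one arc of
the walk provided the two do not cross. [folklore] -/
def snoc (γ : YBWalk D a z) (e : MidEdge) (f : Face) (hf : arcFace (z, e) = some f) (hfD : f ∈ D)
    (he : e ∉ γ.mids) (hch : ∀ i, i + 1 = γ.arcs.length → arcFace (γ.nth i, z) ≠ some f)
    (hnc₁ : IsWE f (z, e) → ∀ i < γ.arcs.length, ¬IsSN f (γ.nth i, γ.nth (i + 1)))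
    (hnc₂ : IsSN f (z, e) → ∀ i < γ.arcs.length, ¬IsWE f (γ.nth i, γ.nth (i + 1))) : YBWalk D a e :=
  (ofFn (γ.arcs.length + 1) (fun i => if i ≤ γ.arcs.length then γ.nth i else e)
    (by
      intro i j hi hj h
      by_cases hi' : i ≤ γ.arcs.length <;> by_cases hj' : j ≤ γ.arcs.length <;> simp only [hi', hj', if_true,
        if_false] at h
      · exact γ.nth_inj hi' hj' h
      · exact absurd (h ▸ γ.nth_mem hi') he
      · exact absurd (h ▸ γ.nth_mem hj') he
      · omega)
    (by
      intro i hi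
      by_cases hi' : i < γ.arcs.length
      · rw [if_pos hi'.le, if_pos (by omega)]; exact γ.arc_nth hi'
      · have : i = γ.arcs.length := by omega
        subst this
        rw [if_pos le_rfl, if_neg (by omega), nth_length]; exact ⟨f, hfD, hf⟩)
    (by
      intro i hi
      by_cases hi' : i + 1 < γ.arcs.length
      · rw [if_pos (by omega), if_pos (by omega), if_pos (by omega)]; exact γ.chain_nth hi'
      · have : i + 1 = γ.arcs.length := by omega
        rw [if_pos (by omega), if_pos (by omega), if_neg (by omega), show i + 1 = γ.arcs.length from this,
          nth_length, hf]
        exact hch i this)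
    (by
      intro i j hi hj f' hWE hSN
      by_cases hi' : i < γ.arcs.length <;> by_cases hj' : j < γ.arcs.length
      · rw [if_pos (by omega), if_pos (by omega)] at hWE hSN
        exact γ.nc_nth hi' hj' f' hWE hSN
      · have : j = γ.arcs.length := by omega
        subst this
        rw [if_pos (by omega), if_pos (by omega)] at hWE
        rw [if_pos le_rfl, if_neg (by omega), nth_length] at hSN
        -- the new arc is `SN` in `f'`, hence `f' = f`
        have hf' : f' = f := by
          rcases hSN with e' | e'
          · have := arcFace_side_side f' .S .N (by decide)
            rw [← e'] at this; rw [this] at hf; exact (Option.some_injective _ hf)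
          · have := arcFace_side_side f' .N .S (by decide)
            rw [← e'] at this; rw [this] at hf; exact (Option.some_injective _ hf)
        subst hf'
        exact hnc₂ hSN i hi' hWE
      · have : i = γ.arcs.length := by omega
        subst this
        rw [if_pos (by omega), if_pos (by omega)] at hSN
        rw [if_pos le_rfl, if_neg (by omega), nth_length] at hWE
        have hf' : f' = f := by
          rcases hWE with e' | e'
          · have := arcFace_side_side f' .W .E (by decide)
            rw [← e'] at this; rw [this] at hf; exact (Option.some_injective _ hf)
          · have := arcFace_side_side f' .E .W (by decide)
            rw [← e'] at this; rw [this] at hf; exact (Option.some_injective _ hf)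
        subst hf'
        exact hnc₁ hWE j hj' hSN
      · have h1 : i = γ.arcs.length := by omega
        have h2 : j = γ.arcs.length := by omega
        subst h1; subst h2
        rw [if_pos le_rfl, if_neg (by omega)] at hWE hSN
        rcases hWE with e₁ | e₁ <;> rcases hSN with e₂ | e₂ <;>
        · have := (Prod.mk.inj (e₁.symm.trans e₂)).1
          exact absurd (f'.side_injective this) (by decide))).cast
    (by rw [if_pos (Nat.zero_le _), nth_zero]) (by rw [if_neg (by omega)])

/-- Appending an arc adds one arc. [folklore] -/
theorem snoc_length (γ : YBWalk D a z) (e : MidEdge) (f : Face) (hf hfD he hch hnc₁ hnc₂) :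
    (γ.snoc e f hf hfD he hch hnc₁ hnc₂).arcs.length = γ.arcs.length + 1 := by
  rw [length_arcs, snoc, cast_mids, ofFn_mids, List.length_ofFn]; omega

/-- `nth` after appending an arc. [folklore] -/
theorem snoc_nth (γ : YBWalk D a z) (e : MidEdge) (f : Face) (hf hfD he hch hnc₁ hnc₂) {i : ℕ} (hi : i ≤ γ.arcs.length) :
    (γ.snoc e f hf hfD he hch hnc₁ hnc₂).nth i = γ.nth i := by
  rw [nth_eq_getElem _ (by rw [snoc, cast_mids, ofFn_mids, List.length_ofFn]; omega)]
  simp [snoc, ofFn_mids, -List.ofFn_succ, hi]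

/-- The arcs after appending an arc. [folklore] -/
theorem snoc_mem_arcs (γ : YBWalk D a z) (e : MidEdge) (f : Face) (hf hfD he hch hnc₁ hnc₂) {p : MidEdge × MidEdge} :
    p ∈ (γ.snoc e f hf hfD he hch hnc₁ hnc₂).arcs ↔ p ∈ γ.arcs ∨ p = (z, e) := by
  show p ∈ arcsOf (γ.snoc e f hf hfD he hch hnc₁ hnc₂).mids ↔ _
  rw [snoc, cast_mids, ofFn_mids, mem_arcsOf_ofFn_iff (v := fun i => if i ≤ γ.arcs.length then γ.nth i else e),
    γ.mem_arcs_iff_nth]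
  constructor
  · rintro ⟨i, hi, rfl⟩
    by_cases hi' : i < γ.arcs.length
    · left; exact ⟨i, hi', by rw [if_pos hi'.le, if_pos (by omega)]⟩
    · right
      have : i = γ.arcs.length := by omega
      subst this
      rw [if_pos le_rfl, if_neg (by omega), nth_length]
  · rintro (⟨i, hi, rfl⟩ | rfl)
    · exact ⟨i, by omega, by rw [if_pos hi.le, if_pos (by omega)]⟩
    · exact ⟨γ.arcs.length, by omega, by rw [if_pos le_rfl, if_neg (by omega), nth_length]⟩

/-! #### Reversing a suffix -/

/-- `arcFace` is symmetric. [folklore] -/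
theorem _root_.Literature.Probability.RandomPlanarGeometry.SAW.YangBaxter.arcFace_swap (x y : MidEdge) :
    arcFace (y, x) = arcFace (x, y) := by
  have key : ∀ (x y : MidEdge) (f : Face), arcFace (x, y) = some f → arcFace (y, x) = some f := by
    intro x y f h
    obtain ⟨s, t, hst, hs, ht, -⟩ := exists_sides_of_arcFace h
    simp only at hs ht
    rw [← hs, ← ht]; exact arcFace_side_side f t s (Ne.symm hst)
  cases h : arcFace (x, y) with
  | some f => exact key _ _ _ h
  | none =>
    cases h' : arcFace (y, x) with
    | none => rfl
    | some g => rw [key _ _ _ h'] at h; exact absurd h (by simp)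

/-- `IsWE` is symmetric. [folklore] -/
theorem _root_.Literature.Probability.RandomPlanarGeometry.SAW.YangBaxter.isWE_swap {f : Face} {x y : MidEdge} :
    IsWE f (y, x) ↔ IsWE f (x, y) := by
  simp only [IsWE, Prod.mk.injEq]; tauto

/-- `IsSN` is symmetric. [folklore] -/
theorem _root_.Literature.Probability.RandomPlanarGeometry.SAW.YangBaxter.isSN_swap {f : Face} {x y : MidEdge} :
    IsSN f (y, x) ↔ IsSN f (x, y) := by
  simp only [IsSN, Prod.mk.injEq]; tauto

/-- A `W–E` arc of `f` lies in `f`. [folklore] -/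
theorem _root_.Literature.Probability.RandomPlanarGeometry.SAW.YangBaxter.arcFace_of_isWE {f : Face} {p : MidEdge × MidEdge}
    (h : IsWE f p) : arcFace p = some f := by
  rcases h with rfl | rfl
  · exact arcFace_side_side f .W .E (by decide)
  · exact arcFace_side_side f .E .W (by decide)

/-- A `S–N` arc of `f` lies in `f`. [folklore] -/
theorem _root_.Literature.Probability.RandomPlanarGeometry.SAW.YangBaxter.arcFace_of_isSN {f : Face} {p : MidEdge × MidEdge}
    (h : IsSN f p) : arcFace p = some f := by
  rcases h with rfl | rfl
  · exact arcFace_side_side f .S .N (by decide)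
  · exact arcFace_side_side f .N .S (by decide)

/-- **Reversing the suffix of a walk after the index `k`**: `z₀ … z_k z_n z_{n-1} … z_{k+1}`, the new
junction arc `z_k → z_n` being drawn in a rhombus `f` carrying no other arc. [folklore] -/
def revSuffix (γ : YBWalk D a z) (k : ℕ) (hk : k < γ.arcs.length) (f : Face)
    (hf : arcFace (γ.nth k, z) = some f) (hfD : f ∈ D)
    (hother : ∀ i < γ.arcs.length, i ≠ k → arcFace (γ.nth i, γ.nth (i + 1)) ≠ some f) :
    YBWalk D a (γ.nth (k + 1)) :=
  (ofFn γ.arcs.length (fun i => if i ≤ k then γ.nth i else γ.nth (γ.arcs.length + k + 1 - i))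
    (by
      intro i j hi hj h
      by_cases hi' : i ≤ k <;> by_cases hj' : j ≤ k <;> simp only [hi', hj', if_true, if_false] at h
      · exact γ.nth_inj (by omega) (by omega) h
      · have := γ.nth_inj (by omega) (by omega) h; omega
      · have := γ.nth_inj (by omega) (by omega) h; omega
      · have := γ.nth_inj (by omega) (by omega) h; omega)
    (by
      intro i hi
      by_cases h1 : i < k
      · rw [if_pos h1.le, if_pos (by omega)]; exact γ.arc_nth (by omega)
      · by_cases h2 : i = k
        · subst h2
          rw [if_pos le_rfl, if_neg (by omega), show γ.arcs.length + i + 1 - (i + 1) = γ.arcs.length by omega,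
            nth_length]
          exact ⟨f, hfD, hf⟩
        · rw [if_neg (by omega), if_neg (by omega), arcFace_swap,
            show γ.arcs.length + k + 1 - i = γ.arcs.length + k + 1 - (i + 1) + 1 by omega]
          exact γ.arc_nth (by omega))
    (by
      intro i hi
      by_cases h1 : i + 1 < k
      · rw [if_pos (by omega), if_pos (by omega), if_pos (by omega)]; exact γ.chain_nth (by omega)
      · by_cases h2 : i + 1 = k
        · rw [if_pos (by omega), if_pos (by omega), if_neg (by omega),
            show γ.arcs.length + k + 1 - (i + 2) = γ.arcs.length by omega, nth_length]
          have hf' := hf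
          rw [← h2] at hf'
          rw [hf']
          exact hother i (by omega) (by omega)
        · by_cases h3 : i = k
          · subst h3
            rw [if_pos le_rfl, if_neg (by omega), if_neg (by omega),
              show γ.arcs.length + i + 1 - (i + 1) = γ.arcs.length by omega, nth_length, hf,
              show γ.arcs.length + i + 1 - (i + 2) = γ.arcs.length - 1 by omega, ne_comm, arcFace_swap]
            have := hother (γ.arcs.length - 1) (by omega) (by omega)
            rwa [show γ.arcs.length - 1 + 1 = γ.arcs.length by omega, nth_length] at this
          · rw [if_neg (by omega), if_neg (by omega), if_neg (by omega)]
            have e1 : γ.arcs.length + k + 1 - i = γ.arcs.length + k + 1 - (i + 2) + 2 := by omega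
            have e2 : γ.arcs.length + k + 1 - (i + 1) = γ.arcs.length + k + 1 - (i + 2) + 1 := by omega
            rw [e1, e2, arcFace_swap, arcFace_swap (γ.nth (γ.arcs.length + k + 1 - (i + 2)))]
            exact (γ.chain_nth (by omega)).symm)
    (by
      -- an arc of the new walk is an old arc, a reversed old arc, or the junction arc (alone in `f`)
      have key : ∀ i < γ.arcs.length, ∀ f' : Face,
          (IsWE f' (if i ≤ k then γ.nth i else γ.nth (γ.arcs.length + k + 1 - i),
              if i + 1 ≤ k then γ.nth (i + 1) else γ.nth (γ.arcs.length + k + 1 - (i + 1))) →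
            (∃ j < γ.arcs.length, j ≠ k ∧ IsWE f' (γ.nth j, γ.nth (j + 1))) ∨ (f' = f ∧ i = k)) ∧
          (IsSN f' (if i ≤ k then γ.nth i else γ.nth (γ.arcs.length + k + 1 - i),
              if i + 1 ≤ k then γ.nth (i + 1) else γ.nth (γ.arcs.length + k + 1 - (i + 1))) →
            (∃ j < γ.arcs.length, j ≠ k ∧ IsSN f' (γ.nth j, γ.nth (j + 1))) ∨ (f' = f ∧ i = k)) := by
        intro i hi f'
        by_cases h1 : i < k
        · rw [if_pos h1.le, if_pos (by omega)]
          exact ⟨fun h => Or.inl ⟨i, hi, by omega, h⟩, fun h => Or.inl ⟨i, hi, by omega, h⟩⟩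
        · by_cases h2 : i = k
          · subst h2
            rw [if_pos le_rfl, if_neg (by omega), show γ.arcs.length + i + 1 - (i + 1) = γ.arcs.length by omega,
              nth_length]
            refine ⟨fun h => Or.inr ⟨?_, rfl⟩, fun h => Or.inr ⟨?_, rfl⟩⟩
            · have := arcFace_of_isWE h; rw [hf] at this; exact (Option.some_injective _ this).symm
            · have := arcFace_of_isSN h; rw [hf] at this; exact (Option.some_injective _ this).symm
          · rw [if_neg (by omega), if_neg (by omega),
              show γ.arcs.length + k + 1 - i = γ.arcs.length + k + 1 - (i + 1) + 1 by omega]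
            refine ⟨fun h => Or.inl ⟨_, by omega, by omega, isWE_swap.1 h⟩,
              fun h => Or.inl ⟨_, by omega, by omega, isSN_swap.1 h⟩⟩
      intro i j hi hj f' hWE hSN
      rcases (key i hi f').1 hWE with ⟨i', hi', hik, hWE'⟩ | ⟨rfl, rfl⟩ <;>
        rcases (key j hj f').2 hSN with ⟨j', hj', hjk, hSN'⟩ | ⟨hff, rfl⟩
      · exact γ.nc_nth hi' hj' f' hWE' hSN'
      · subst hff; exact hother i' hi' hik (arcFace_of_isWE hWE')
      · exact hother j' hj' hjk (arcFace_of_isSN hSN')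
      · -- the junction arc cannot be both `WE` and `SN`
        rw [if_pos le_rfl, if_neg (by omega)] at hWE hSN
        rcases hWE with e₁ | e₁ <;> rcases hSN with e₂ | e₂ <;>
        · have := (Prod.mk.inj (e₁.symm.trans e₂)).1
          exact absurd (f'.side_injective this) (by decide))).cast
    (by rw [if_pos (Nat.zero_le _), nth_zero])
    (by rw [if_neg (by omega), show γ.arcs.length + k + 1 - γ.arcs.length = k + 1 by omega])

/-- Reversing a suffix keeps the number of arcs. [folklore] -/
theorem revSuffix_length (γ : YBWalk D a z) (k : ℕ) (hk f hf hfD hother) :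
    (γ.revSuffix k hk f hf hfD hother).arcs.length = γ.arcs.length := by
  rw [length_arcs, revSuffix, cast_mids, ofFn_mids, List.length_ofFn]; omega

/-- `nth` after reversing a suffix. [folklore] -/
theorem revSuffix_nth (γ : YBWalk D a z) (k : ℕ) (hk f hf hfD hother) {i : ℕ} (hi : i ≤ γ.arcs.length) :
    (γ.revSuffix k hk f hf hfD hother).nth i = if i ≤ k then γ.nth i else γ.nth (γ.arcs.length + k + 1 - i) := by
  rw [nth_eq_getElem _ (by rw [revSuffix, cast_mids, ofFn_mids, List.length_ofFn]; omega)]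
  simp [revSuffix, ofFn_mids, -List.ofFn_succ]

/-! #### Taking a prefix -/

/-- **The prefix of a walk up to the index `k`.** [folklore] -/
def take (γ : YBWalk D a z) (k : ℕ) (hk : k ≤ γ.arcs.length) : YBWalk D a (γ.nth k) :=
  (ofFn k γ.nth
    (fun i j hi hj h => γ.nth_inj (by omega) (by omega) h)
    (fun i hi => γ.arc_nth (by omega))
    (fun i hi => γ.chain_nth (by omega))
    (fun i j hi hj f hWE => γ.nc_nth (by omega) (by omega) f hWE)).cast γ.nth_zero rfl

/-- The prefix up to `k` has `k` arcs. [folklore] -/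
theorem take_length (γ : YBWalk D a z) (k : ℕ) (hk : k ≤ γ.arcs.length) : (γ.take k hk).arcs.length = k := by
  rw [length_arcs, take, cast_mids, ofFn_mids, List.length_ofFn]; omega

/-- `nth` of a prefix. [folklore] -/
theorem take_nth (γ : YBWalk D a z) (k : ℕ) (hk : k ≤ γ.arcs.length) {i : ℕ} (hi : i ≤ k) :
    (γ.take k hk).nth i = γ.nth i := by
  rw [nth_eq_getElem _ (by rw [take, cast_mids, ofFn_mids, List.length_ofFn]; omega)]
  simp [take, ofFn_mids, -List.ofFn_succ]

/-! #### The arcs of the modified walks, as lists -/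

/-- The arcs of a prefix. [folklore] -/
theorem take_arcs (γ : YBWalk D a z) (k : ℕ) (hk : k ≤ γ.arcs.length) : (γ.take k hk).arcs = γ.arcs.take k := by
  apply List.ext_getElem
  · rw [take_length, List.length_take]; omega
  · intro i h1 h2
    rw [arcs_getElem_eq_nth _ h1, List.getElem_take, arcs_getElem_eq_nth _ (by rw [take_length] at h1; omega),
      take_nth _ _ _ (by rw [take_length] at h1; omega), take_nth _ _ _ (by rw [take_length] at h1; omega)]

/-- The arcs after dropping the last arc, as a list. [folklore] -/
theorem dropLast_arcs (γ : YBWalk D a z) (hn : 0 < γ.arcs.length) :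
    (γ.dropLast hn).arcs = γ.arcs.take (γ.arcs.length - 1) := by
  apply List.ext_getElem
  · rw [dropLast_length, List.length_take]; omega
  · intro i h1 h2
    rw [arcs_getElem_eq_nth _ h1, List.getElem_take, arcs_getElem_eq_nth _ (by rw [dropLast_length] at h1; omega),
      dropLast_nth _ _ (by rw [dropLast_length] at h1; omega), dropLast_nth _ _ (by rw [dropLast_length] at h1; omega)]

/-- The arcs after appending an arc, as a list. [folklore] -/
theorem snoc_arcs (γ : YBWalk D a z) (e : MidEdge) (f : Face) (hf hfD he hch hnc₁ hnc₂) :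
    (γ.snoc e f hf hfD he hch hnc₁ hnc₂).arcs = γ.arcs ++ [(z, e)] := by
  apply List.ext_getElem
  · rw [snoc_length, List.length_append, List.length_singleton]
  · intro i h1 h2
    rw [snoc_length] at h1
    rw [arcs_getElem_eq_nth _ (by rw [snoc_length]; omega), List.getElem_append]
    by_cases hi : i < γ.arcs.length
    · rw [dif_pos hi, arcs_getElem_eq_nth _ hi, snoc_nth _ _ _ _ _ _ _ _ _ hi.le, snoc_nth _ _ _ _ _ _ _ _ _ (by omega)]
    · have hi' : i = γ.arcs.length := by omega
      subst hi'
      rw [dif_neg (lt_irrefl _), snoc_nth _ _ _ _ _ _ _ _ _ le_rfl, nth_length]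
      simp only [Nat.sub_self, List.getElem_cons_zero, Prod.mk.injEq, true_and]
      rw [nth_eq_getElem _ (by rw [snoc, cast_mids, ofFn_mids, List.length_ofFn]; omega)]
      simp [snoc, ofFn_mids, -List.ofFn_succ]

/-- The arcs after reversing a suffix, as a list: prefix, junction, reversed suffix. [folklore] -/
theorem revSuffix_arcs (γ : YBWalk D a z) (k : ℕ) (hk f hf hfD hother) :
    (γ.revSuffix k hk f hf hfD hother).arcs =
      γ.arcs.take k ++ [(γ.nth k, z)] ++ ((γ.arcs.drop (k + 1)).reverse.map Prod.swap) := by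
  apply List.ext_getElem
  · simp only [revSuffix_length, List.length_append, List.length_take, List.length_singleton, List.length_map,
      List.length_reverse, List.length_drop]
    omega
  · intro i h1 h2
    rw [revSuffix_length] at h1
    rw [arcs_getElem_eq_nth _ (by rw [revSuffix_length]; omega), revSuffix_nth _ _ _ _ _ _ _ (by omega),
      revSuffix_nth _ _ _ _ _ _ _ (by omega)]
    rw [List.getElem_append]
    by_cases hik : i < k
    · rw [dif_pos (by simp; omega), List.getElem_append, dif_pos (by simp; omega), List.getElem_take,
        arcs_getElem_eq_nth _ (by omega), if_pos hik.le, if_pos (by omega)]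
    · by_cases hik' : i = k
      · subst hik'
        rw [dif_pos (by simp; omega), List.getElem_append, dif_neg (by simp), if_pos le_rfl, if_neg (by omega)]
        simp only [List.length_take, show min i γ.arcs.length = i from by omega, Nat.sub_self, List.getElem_cons_zero,
          show γ.arcs.length + i + 1 - (i + 1) = γ.arcs.length by omega, nth_length]
      · rw [dif_neg (by simp; omega), if_neg (by omega), if_neg (by omega)]
        simp only [List.length_append, List.length_take, List.length_singleton, List.getElem_map, List.getElem_reverse,
          List.length_drop, List.getElem_drop]
        rw [arcs_getElem_eq_nth _ (by omega), Prod.swap_prod_mk, Prod.mk.injEq]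
        constructor
        · congr 1; omega
        · congr 1; omega

end YBWalk

/-! ### Symmetry of the local data of an arc; weights of the modified walks -/

/-- `arcKind` is symmetric. [folklore] -/
theorem arcKind_swap (s t : Side) : arcKind t s = arcKind s t := by cases s <;> cases t <;> rfl

/-- `arcKindOf` through the sides. [folklore] -/
theorem arcKindOf_eq {p : MidEdge × MidEdge} {f : Face} (h : arcFace p = some f) {s t : Side}
    (hs : f.side s = p.1) (ht : f.side t = p.2) : arcKindOf p = some (arcKind s t) := by
  unfold arcKindOf
  rw [h, Option.bind_some, ← hs, ← ht, Face.sideOf_side, Face.sideOf_side]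

/-- `arcKindOf` is symmetric. [folklore] -/
theorem arcKindOf_swap (x y : MidEdge) : arcKindOf (y, x) = arcKindOf (x, y) := by
  cases h : arcFace (x, y) with
  | none =>
    have h' : arcFace (y, x) = none := by rw [arcFace_swap, h]
    simp [arcKindOf, h, h']
  | some f =>
    obtain ⟨s, t, -, hs, ht, hk⟩ := exists_sides_of_arcFace h
    have h' : arcFace (y, x) = some f := by rw [arcFace_swap, h]
    rw [hk, arcKindOf_eq h' ht hs, arcKind_swap]

/-- `arcTurn` is antisymmetric. [folklore] -/
theorem arcTurn_swap (θ : ℝ) (s t : Side) : arcTurn θ t s = -arcTurn θ s t := by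
  cases s <;> cases t <;> simp [arcTurn]

/-- `arcTurnOf` is antisymmetric. [folklore] -/
theorem arcTurnOf_swap (Θ : ℤ → ℝ) (x y : MidEdge) : arcTurnOf Θ (y, x) = -arcTurnOf Θ (x, y) := by
  cases h : arcFace (x, y) with
  | none =>
    have h' : arcFace (y, x) = none := by rw [arcFace_swap, h]
    simp [arcTurnOf, h, h']
  | some f =>
    obtain ⟨s, t, -, hs, ht, -⟩ := exists_sides_of_arcFace h
    have h' : arcFace (y, x) = some f := by rw [arcFace_swap, h]
    simp only [arcTurnOf, h, h']
    simp only at hs ht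
    rw [← hs, ← ht, Face.sideOf_side, Face.sideOf_side]
    exact arcTurn_swap _ _ _

/-- Three arcs or more in a rhombus have weight `0`. [folklore] -/
theorem localWeight_three (θ : ℝ) (a b c : ArcKind) (l : List ArcKind) : localWeight θ (a :: b :: c :: l) = 0 := by
  cases a <;> cases b <;> rfl

/-- The weight of two arcs is symmetric. [folklore] -/
theorem localWeight_pair_swap (θ : ℝ) (x y : ArcKind) : localWeight θ [x, y] = localWeight θ [y, x] := by
  cases x <;> cases y <;> rfl

/-- The local weight of a rhombus only depends on the multiset of kinds of its arcs. [folklore] -/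
theorem localWeight_perm (θ : ℝ) {l l' : List ArcKind} (h : l.Perm l') : localWeight θ l = localWeight θ l' := by
  have hl := h.length_eq
  match l, l', hl with
  | [], [], _ => rfl
  | [x], [y], _ => rw [List.singleton_perm_singleton.1 h]
  | [x, y], [x', y'], _ =>
    have hx' : x' ∈ [x, y] := h.symm.subset (by simp)
    have hy' : y' ∈ [x, y] := h.symm.subset (by simp)
    have hx : x ∈ [x', y'] := h.subset (by simp)
    have hy : y ∈ [x', y'] := h.subset (by simp)
    simp only [List.mem_cons, List.not_mem_nil, or_false] at hx' hy' hx hy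
    rcases hx' with rfl | rfl <;> rcases hy' with rfl | rfl
    · rcases hy with rfl | rfl <;> rfl
    · rfl
    · exact localWeight_pair_swap θ _ _
    · rcases hx with rfl | rfl <;> rfl
  | _ :: _ :: _ :: _, _ :: _ :: _ :: _, _ => rw [localWeight_three, localWeight_three]

/-! ### Kinds, visited faces, weights and windings through the list of arcs -/

/-- The kind of an arc if it lies in the rhombus `g`. [folklore] -/
def kindF (g : Face) (p : MidEdge × MidEdge) : Option ArcKind := if arcFace p = some g then arcKindOf p else none

/-- `kindF` is symmetric. [folklore] -/
theorem kindF_swap (g : Face) (x y : MidEdge) : kindF g (y, x) = kindF g (x, y) := by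
  simp only [kindF, arcFace_swap, arcKindOf_swap]

/-- `kindF g` vanishes on arcs outside `g`. [folklore] -/
theorem kindF_of_ne {g : Face} {p : MidEdge × MidEdge} (h : arcFace p ≠ some g) : kindF g p = none := by
  simp [kindF, h]

/-- `kindF` of two sides of `g`. [folklore] -/
theorem kindF_side_side (g : Face) {s t : Side} (hst : s ≠ t) : kindF g (g.side s, g.side t) = some (arcKind s t) := by
  rw [kindF, if_pos (arcFace_side_side g s t hst), arcKindOf_eq (arcFace_side_side g s t hst) rfl rfl]

namespace YBWalk

variable {D : Set Face} {a z : MidEdge}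

/-- `kindsIn` through `kindF`. [folklore] -/
theorem kindsIn_eq (γ : YBWalk D a z) (g : Face) : γ.kindsIn g = γ.arcs.filterMap (kindF g) := rfl

/-- `facesVisited` through the list of arcs. [folklore] -/
theorem facesVisited_eq (γ : YBWalk D a z) : γ.facesVisited = (γ.arcs.filterMap arcFace).toFinset := rfl

/-- A rhombus is visited iff it carries an arc. [folklore] -/
theorem mem_facesVisited_iff (γ : YBWalk D a z) {g : Face} : g ∈ γ.facesVisited ↔ ∃ p ∈ γ.arcs, arcFace p = some g := by
  simp [facesVisited_eq, List.mem_filterMap]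

/-- The winding as a list sum. [folklore] -/
theorem winding_eq_map_sum (γ : YBWalk D a z) (Θ : ℤ → ℝ) : γ.winding Θ = (γ.arcs.map (arcTurnOf Θ)).sum := rfl

/-- A rhombus without arcs contributes the empty list. [folklore] -/
theorem kindsIn_eq_nil {γ : YBWalk D a z} {g : Face} (h : g ∉ γ.facesVisited) : γ.kindsIn g = [] := by
  rw [kindsIn_eq, List.filterMap_eq_nil_iff]
  intro p hp
  rw [mem_facesVisited_iff] at h
  exact kindF_of_ne fun hpg => h ⟨p, hp, hpg⟩

/-- **The weight splits off any rhombus.** [folklore] -/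
theorem weight_eq_erase_mul (γ : YBWalk D a z) (Θ : ℤ → ℝ) (r : Face) :
    γ.weight Θ = (∏ g ∈ γ.facesVisited.erase r, localWeight (Θ g.1) (γ.kindsIn g)) * localWeight (Θ r.1) (γ.kindsIn r) := by
  rw [weight]
  by_cases hr : r ∈ γ.facesVisited
  · rw [Finset.prod_erase_mul _ _ hr]
  · rw [Finset.erase_eq_of_notMem hr, kindsIn_eq_nil hr, localWeight, mul_one]

/-- The exterior weight: the product of the local weights of the rhombi other than `r`. [folklore] -/
def extWeight (γ : YBWalk D a z) (Θ : ℤ → ℝ) (r : Face) : ℝ :=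
  ∏ g ∈ γ.facesVisited.erase r, localWeight (Θ g.1) (γ.kindsIn g)

/-- The weight is the exterior weight times the local weight of `r`. [folklore] -/
theorem weight_eq_extWeight_mul (γ : YBWalk D a z) (Θ : ℤ → ℝ) (r : Face) :
    γ.weight Θ = γ.extWeight Θ r * localWeight (Θ r.1) (γ.kindsIn r) := γ.weight_eq_erase_mul Θ r

/-- **Exterior weights agree** for two walks with the same visited rhombi and, outside `r`, the same
kinds up to order. [folklore] -/
theorem extWeight_congr {a' z' : MidEdge} (γ : YBWalk D a z) (δ : YBWalk D a' z') (Θ : ℤ → ℝ) (r : Face)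
    (hfv : δ.facesVisited = γ.facesVisited) (hk : ∀ g, g ≠ r → (δ.kindsIn g).Perm (γ.kindsIn g)) :
    δ.extWeight Θ r = γ.extWeight Θ r := by
  rw [extWeight, extWeight, hfv]
  refine Finset.prod_congr rfl fun g hg => ?_
  exact localWeight_perm _ (hk g (Finset.ne_of_mem_erase hg))

/-! #### Appending an arc in `r` -/

section snoc

variable (γ : YBWalk D a z) {a' z'' e : MidEdge} (δ : YBWalk D a' z'') (r : Face) (harcs : δ.arcs = γ.arcs ++ [(z, e)])
  (hr : arcFace (z, e) = some r)
include harcs hr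

/-- Appending an arc in `r` visits `r`. [folklore] -/
theorem facesVisited_of_snoc : δ.facesVisited = insert r γ.facesVisited := by
  rw [facesVisited_eq, harcs, List.filterMap_append, List.toFinset_append, facesVisited_eq]
  simp [hr, Finset.union_comm]

/-- Appending an arc in `r` does not change the other rhombi. [folklore] -/
theorem kindsIn_of_snoc_of_ne {g : Face} (hg : g ≠ r) : δ.kindsIn g = γ.kindsIn g := by
  rw [kindsIn_eq, harcs, List.filterMap_append, kindsIn_eq, List.filterMap_cons,
    kindF_of_ne (show arcFace (z, e) ≠ some g by rw [hr]; simpa using Ne.symm hg)]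
  simp

/-- Appending an arc in `r` appends its kind in `r`. [folklore] -/
theorem kindsIn_of_snoc : δ.kindsIn r = γ.kindsIn r ++ [arcKindOf (z, e)].reduceOption := by
  rw [kindsIn_eq, harcs, List.filterMap_append, kindsIn_eq]
  simp [kindF, hr, List.reduceOption, List.filterMap_cons]

/-- Appending an arc in `r` does not change the exterior weight. [folklore] -/
theorem extWeight_of_snoc (Θ : ℤ → ℝ) : δ.extWeight Θ r = γ.extWeight Θ r := by
  rw [extWeight, extWeight, facesVisited_of_snoc γ δ r harcs hr, Finset.erase_insert_eq_erase]
  refine Finset.prod_congr rfl fun g hg => ?_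
  rw [kindsIn_of_snoc_of_ne γ δ r harcs hr (Finset.ne_of_mem_erase hg)]

omit hr in
/-- Appending an arc adds its rotation to the winding. [folklore] -/
theorem winding_of_snoc (Θ : ℤ → ℝ) : δ.winding Θ = γ.winding Θ + arcTurnOf Θ (z, e) := by
  rw [winding_eq_map_sum, harcs, winding_eq_map_sum]; simp

end snoc

/-! #### Reversing a suffix with junction in `r` -/

/-- A list splits at an index. [folklore] -/
theorem list_eq_take_cons_drop {α : Type*} (l : List α) {k : ℕ} (hk : k < l.length) :
    l = l.take k ++ [l[k]'hk] ++ l.drop (k + 1) := by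
  rw [List.append_assoc, List.singleton_append, ← List.drop_eq_getElem_cons, List.take_append_drop]

/-- `filterMap` of a symmetric function over a reversed, swapped list. [folklore] -/
theorem filterMap_swap_reverse {β : Type*} (F : MidEdge × MidEdge → Option β) (hF : ∀ x y, F (y, x) = F (x, y))
    (l : List (MidEdge × MidEdge)) : (l.reverse.map Prod.swap).filterMap F = (l.filterMap F).reverse := by
  rw [List.filterMap_map, List.filterMap_reverse]
  congr 1
  apply List.filterMap_congr
  intro p _
  obtain ⟨x, y⟩ := p
  show F (y, x) = F (x, y)
  exact hF x y

/-- Reversing and swapping the arcs negates the total rotation. [folklore] -/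
theorem sum_map_arcTurnOf_swap (Θ : ℤ → ℝ) (l : List (MidEdge × MidEdge)) :
    ((l.reverse.map Prod.swap).map (arcTurnOf Θ)).sum = -(l.map (arcTurnOf Θ)).sum := by
  rw [List.map_map, List.map_reverse, List.sum_reverse]
  induction l with
  | nil => simp
  | cons p l ih =>
    obtain ⟨x, y⟩ := p
    simp only [List.map_cons, List.sum_cons, Function.comp_apply, Prod.swap_prod_mk] at ih ⊢
    rw [ih, arcTurnOf_swap]; ring

section revSuffix

variable (γ : YBWalk D a z) {z' : MidEdge} (δ : YBWalk D a z') (r : Face) (k : ℕ) (j : MidEdge × MidEdge)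
  (harcs : δ.arcs = γ.arcs.take k ++ [j] ++ ((γ.arcs.drop (k + 1)).reverse.map Prod.swap))
  (hj : arcFace j = some r) (hk : k < γ.arcs.length) (hkr : arcFace (γ.arcs[k]'hk) = some r)
  (hother : ∀ p ∈ γ.arcs, p ≠ γ.arcs[k]'hk → arcFace p ≠ some r)
include harcs hj hkr

/-- Reversing a suffix visits the same rhombi. [folklore] -/
theorem facesVisited_of_revSuffix : δ.facesVisited = γ.facesVisited := by
  rw [facesVisited_eq, facesVisited_eq, harcs]
  conv_rhs => rw [list_eq_take_cons_drop γ.arcs hk]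
  simp only [List.filterMap_append, List.toFinset_append, List.filterMap_cons, List.filterMap_nil, hj, hkr,
    filterMap_swap_reverse arcFace (fun x y => arcFace_swap x y), List.toFinset_reverse]

/-- Reversing a suffix permutes the kinds in the rhombi other than `r`. [folklore] -/
theorem kindsIn_of_revSuffix_of_ne {g : Face} (hg : g ≠ r) :
    (δ.kindsIn g).Perm (γ.kindsIn g) := by
  rw [kindsIn_eq, kindsIn_eq, harcs]
  conv_rhs => rw [list_eq_take_cons_drop γ.arcs hk]
  simp only [List.filterMap_append, List.filterMap_cons, List.filterMap_nil,
    kindF_of_ne (show arcFace j ≠ some g by rw [hj]; simpa using Ne.symm hg),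
    kindF_of_ne (show arcFace (γ.arcs[k]'hk) ≠ some g by rw [hkr]; simpa using Ne.symm hg),
    filterMap_swap_reverse (kindF g) (fun x y => kindF_swap g x y), List.append_nil]
  exact List.Perm.append_left _ (List.reverse_perm _)

include hother

omit hkr in
/-- After reversing a suffix, `r` carries only the junction arc. [folklore] -/
theorem kindsIn_of_revSuffix : δ.kindsIn r = [arcKindOf j].reduceOption := by
  rw [kindsIn_eq, harcs]
  have h0 : ∀ p ∈ γ.arcs.take k ++ (γ.arcs.drop (k + 1)).reverse.map Prod.swap, kindF r p = none := by
    intro p hp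
    rw [List.mem_append] at hp
    rcases hp with hp | hp
    · refine kindF_of_ne (hother p (List.mem_of_mem_take hp) fun hpk => ?_)
      -- `p` in the prefix is not the `k`-th arc (arcs are distinct)
      obtain ⟨i, hi, rfl⟩ := List.mem_iff_getElem.1 hp
      rw [List.getElem_take] at hpk
      have := (γ.nodup_arcs.getElem_inj_iff).1 hpk
      rw [List.length_take] at hi; omega
    · rw [List.mem_map] at hp
      obtain ⟨q, hq, rfl⟩ := hp
      rw [List.mem_reverse] at hq
      obtain ⟨x, y⟩ := q
      rw [Prod.swap_prod_mk, kindF_swap]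
      refine kindF_of_ne (hother _ (List.mem_of_mem_drop hq) fun hpk => ?_)
      obtain ⟨i, hi, e⟩ := List.mem_iff_getElem.1 hq
      rw [List.getElem_drop] at e
      rw [← e] at hpk
      have := (γ.nodup_arcs.getElem_inj_iff).1 hpk
      omega
  rw [List.filterMap_append, List.filterMap_append]
  rw [List.filterMap_eq_nil_iff.2 fun p hp => h0 p (List.mem_append_left _ hp),
    List.filterMap_eq_nil_iff.2 fun p hp => h0 p (List.mem_append_right _ hp)]
  simp [kindF, hj, List.reduceOption, List.filterMap_cons]

omit harcs hj in
/-- Before reversing, `r` carries only the `k`-th arc. [folklore] -/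
theorem kindsIn_orig_of_revSuffix : γ.kindsIn r = [arcKindOf (γ.arcs[k]'hk)].reduceOption := by
  rw [kindsIn_eq]
  conv_lhs => rw [list_eq_take_cons_drop γ.arcs hk]
  have h0 : ∀ p ∈ γ.arcs.take k ++ γ.arcs.drop (k + 1), kindF r p = none := by
    intro p hp
    rw [List.mem_append] at hp
    rcases hp with hp | hp
    · refine kindF_of_ne (hother p (List.mem_of_mem_take hp) fun hpk => ?_)
      obtain ⟨i, hi, rfl⟩ := List.mem_iff_getElem.1 hp
      rw [List.getElem_take] at hpk
      have := (γ.nodup_arcs.getElem_inj_iff).1 hpk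
      rw [List.length_take] at hi; omega
    · refine kindF_of_ne (hother _ (List.mem_of_mem_drop hp) fun hpk => ?_)
      obtain ⟨i, hi, e⟩ := List.mem_iff_getElem.1 hp
      rw [List.getElem_drop] at e
      rw [← e] at hpk
      have := (γ.nodup_arcs.getElem_inj_iff).1 hpk
      omega
  rw [List.filterMap_append, List.filterMap_append,
    List.filterMap_eq_nil_iff.2 fun p hp => h0 p (List.mem_append_left _ hp),
    List.filterMap_eq_nil_iff.2 fun p hp => h0 p (List.mem_append_right _ hp)]
  simp [kindF, hkr, List.reduceOption, List.filterMap_cons]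

omit hother in
/-- Reversing a suffix does not change the exterior weight. [folklore] -/
theorem extWeight_of_revSuffix (Θ : ℤ → ℝ) : δ.extWeight Θ r = γ.extWeight Θ r :=
  extWeight_congr γ δ Θ r (facesVisited_of_revSuffix γ δ r k j harcs hj hk hkr)
    fun _ hg => kindsIn_of_revSuffix_of_ne γ δ r k j harcs hj hk hkr hg

omit hj hkr hother in
/-- The winding after reversing a suffix: prefix plus junction minus suffix. [folklore] -/
theorem winding_of_revSuffix (Θ : ℤ → ℝ) :
    δ.winding Θ = ((γ.arcs.take k).map (arcTurnOf Θ)).sum + arcTurnOf Θ j -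
      ((γ.arcs.drop (k + 1)).map (arcTurnOf Θ)).sum := by
  rw [winding_eq_map_sum, harcs]
  simp only [List.map_append, List.sum_append, List.map_cons, List.map_nil, List.sum_cons, List.sum_nil, add_zero,
    sum_map_arcTurnOf_swap]
  ring

omit harcs hj hkr hother in
/-- The winding split at the `k`-th arc. [folklore] -/
theorem winding_orig_split (Θ : ℤ → ℝ) :
    γ.winding Θ = ((γ.arcs.take k).map (arcTurnOf Θ)).sum + arcTurnOf Θ (γ.arcs[k]'hk) +
      ((γ.arcs.drop (k + 1)).map (arcTurnOf Θ)).sum := by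
  rw [winding_eq_map_sum]
  conv_lhs => rw [list_eq_take_cons_drop γ.arcs hk]
  simp only [List.map_append, List.sum_append, List.map_cons, List.map_nil, List.sum_cons, List.sum_nil, add_zero]

end revSuffix

end YBWalk


/-! ### Walks at the boundary of a rhombus: the first visit and the structure after it -/

/-- Faces of two arcs at a side of `r` that lie in different rhombi: one of them is `r`. [folklore] -/
theorem face_eq_or_of_side {r f f' : Face} {s : Side} {x y : MidEdge}
    (hf : arcFace (x, r.side s) = some f) (hf' : arcFace (r.side s, y) = some f') (hne : f ≠ f') : f = r ∨ f' = r := by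
  obtain ⟨-, -, h1⟩ := MidEdge.commonFace_eq_some hf
  obtain ⟨-, h2, -⟩ := MidEdge.commonFace_eq_some hf'
  have hr := (Face.exists_side_eq_iff r (r.side s)).1 ⟨s, rfl⟩
  simp only at h1 h2
  rcases h1 with h1 | h1 <;> rcases h2 with h2 | h2
  · exact absurd (h1.trans h2.symm) hne
  · rcases hr with hr | hr
    · left; exact h1.trans hr.symm
    · right; exact h2.trans hr.symm
  · rcases hr with hr | hr
    · right; exact h2.trans hr.symm
    · left; exact h1.trans hr.symm
  · exact absurd (h1.trans h2.symm) hne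

/-- The face of an arc at a side of `r` is `r` or the other face of that side. [folklore] -/
theorem face_eq_or_eq_of_side_left {r f : Face} {s : Side} {y : MidEdge} (hf : arcFace (r.side s, y) = some f) :
    f = r ∨ (f ≠ r ∧ ∀ f', arcFace (r.side s, y) = some f' → f' = f) := by
  by_cases h : f = r
  · exact Or.inl h
  · exact Or.inr ⟨h, fun f' hf'' => by rw [hf] at hf''; exact (Option.some_injective _ hf'').symm⟩

namespace YBWalk

variable {D : Set Face} {a z : MidEdge} (γ : YBWalk D a z) (r : Face)

/-- The indices at which the walk crosses a side of `r`. [folklore] -/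
def hitIdx : Finset ℕ := (Finset.range (γ.arcs.length + 1)).filter fun i => ∃ s, γ.nth i = r.side s

/-- Membership in the hit indices. [folklore] -/
theorem mem_hitIdx {i : ℕ} : i ∈ γ.hitIdx r ↔ i ≤ γ.arcs.length ∧ ∃ s, γ.nth i = r.side s := by
  simp [hitIdx]

variable {γ r}

/-- An arc of the walk in `r` gives two consecutive hits. [folklore] -/
theorem mem_hitIdx_of_arcFace {i : ℕ} (hi : i < γ.arcs.length) (h : arcFace (γ.nth i, γ.nth (i + 1)) = some r) :
    i ∈ γ.hitIdx r ∧ i + 1 ∈ γ.hitIdx r := by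
  obtain ⟨s, t, -, hs, ht, -⟩ := exists_sides_of_arcFace h
  exact ⟨(mem_hitIdx γ r).2 ⟨hi.le, s, hs.symm⟩, (mem_hitIdx γ r).2 ⟨by omega, t, ht.symm⟩⟩

/-- **The arc after a first visit enters `r`**: if the walk crosses a side of `r` at the index
`i > 0`, not at `i - 1`, and continues, then its `i`-th arc lies in `r`. [folklore] -/
theorem arcFace_eq_of_first_hit {i : ℕ} (hi0 : 0 < i) (hi : i < γ.arcs.length) {s : Side} (hs : γ.nth i = r.side s)
    (hprev : i - 1 ∉ γ.hitIdx r) : arcFace (γ.nth i, γ.nth (i + 1)) = some r := by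
  obtain ⟨f, -, hf⟩ := γ.arc_nth (show i - 1 < γ.arcs.length by omega)
  obtain ⟨f', -, hf'⟩ := γ.arc_nth hi
  rw [show i - 1 + 1 = i by omega] at hf
  have hne : f ≠ f' := by
    intro e; subst e
    have := γ.chain_nth (i := i - 1) (by omega)
    rw [show i - 1 + 1 = i by omega, show i - 1 + 2 = i + 1 by omega, hf, hf'] at this
    exact this rfl
  rw [hs] at hf hf'
  rcases face_eq_or_of_side hf hf' hne with rfl | rfl
  · exact absurd (mem_hitIdx_of_arcFace (by omega) (by rw [show i - 1 + 1 = i by omega, hs]; exact hf)).1 hprev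
  · rw [hs]; exact hf'

/-- Symmetric version: the arc before a last visit exits `r`. If the walk crosses a side of `r` at
`i`, not at `i + 1 ≤ n`, and `i > 0`, then its `(i-1)`-st arc lies in `r`. [folklore] -/
theorem arcFace_eq_of_last_hit {i : ℕ} (hi0 : 0 < i) (hi : i < γ.arcs.length) {s : Side} (hs : γ.nth i = r.side s)
    (hnext : i + 1 ∉ γ.hitIdx r) : arcFace (γ.nth (i - 1), γ.nth i) = some r := by
  obtain ⟨f, -, hf⟩ := γ.arc_nth (show i - 1 < γ.arcs.length by omega)
  obtain ⟨f', -, hf'⟩ := γ.arc_nth hi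
  rw [show i - 1 + 1 = i by omega] at hf
  have hne : f ≠ f' := by
    intro e; subst e
    have := γ.chain_nth (i := i - 1) (by omega)
    rw [show i - 1 + 1 = i by omega, show i - 1 + 2 = i + 1 by omega, hf, hf'] at this
    exact this rfl
  rw [hs] at hf hf'
  rcases face_eq_or_of_side hf hf' hne with rfl | rfl
  · rw [hs]; exact hf
  · exact absurd (mem_hitIdx_of_arcFace hi (by rw [hs]; exact hf')).2 hnext

/-! #### Walks of the rectangle ending on the boundary of `r` -/

section Rect

variable {T L : ℕ} {r : Face} {sE : Side} (γ : YBWalk (rect T L) origin (r.side sE))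

/-- The last index is a hit. [folklore] -/
theorem length_mem_hitIdx : γ.arcs.length ∈ γ.hitIdx r := (mem_hitIdx γ r).2 ⟨le_rfl, sE, γ.nth_length⟩

/-- There is a hit. [folklore] -/
theorem hitIdx_nonempty : (γ.hitIdx r).Nonempty := ⟨_, γ.length_mem_hitIdx⟩

/-- The index of the first crossing of a side of `r`. [folklore] -/
def firstHit : ℕ := (γ.hitIdx r).min' γ.hitIdx_nonempty

/-- The first hit is a hit. [folklore] -/
theorem firstHit_mem : γ.firstHit ∈ γ.hitIdx r := Finset.min'_mem _ _

/-- The first hit is an index of the walk. [folklore] -/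
theorem firstHit_le : γ.firstHit ≤ γ.arcs.length := ((mem_hitIdx γ r).1 γ.firstHit_mem).1

/-- No hit before the first hit. [folklore] -/
theorem not_mem_hitIdx_of_lt_firstHit {i : ℕ} (h : i < γ.firstHit) : i ∉ γ.hitIdx r :=
  fun hi => (Finset.min'_le _ _ hi).not_gt h

/-- The first hit is the least hit. [folklore] -/
theorem firstHit_le_of_mem {i : ℕ} (hi : i ∈ γ.hitIdx r) : γ.firstHit ≤ i := Finset.min'_le _ _ hi

/-- The side of `r` first crossed. [folklore] -/
def firstSide : Side := Classical.choose ((mem_hitIdx γ r).1 γ.firstHit_mem).2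

/-- The mid-edge at the first hit is the first side. [folklore] -/
theorem nth_firstHit : γ.nth γ.firstHit = r.side γ.firstSide := Classical.choose_spec ((mem_hitIdx γ r).1 γ.firstHit_mem).2

variable (hr : r ∈ rect T L)
include hr

/-- **After the first crossing of `∂r` the walk enters `r`** (if it continues). [folklore] -/
theorem arcFace_firstHit (h : γ.firstHit < γ.arcs.length) : arcFace (γ.nth γ.firstHit, γ.nth (γ.firstHit + 1)) = some r := by
  rcases Nat.eq_zero_or_pos γ.firstHit with h0 | hpos
  · -- the walk starts on `∂r`: `r = (0,0)` and the first arc lies in it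
    have hs := γ.nth_firstHit
    rw [h0, nth_zero] at hs
    obtain ⟨f, hfD, hf⟩ := γ.arc_nth h
    rw [h0] at hf ⊢
    rw [nth_zero] at hf ⊢
    obtain ⟨-, h1, -⟩ := MidEdge.commonFace_eq_some hf
    have hr' := (Face.exists_side_eq_iff r origin).1 ⟨_, hs.symm⟩
    simp only [origin, MidEdge.faces] at h1 hr'
    have hf0 : f = (0, 0) := by
      rcases h1 with h1 | h1
      · exfalso; have := hfD.1; rw [h1] at this; simp at this
      · simpa using h1
    have hr0 : r = (0, 0) := by
      rcases hr' with h2 | h2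
      · exfalso; have := hr.1; rw [h2] at this; simp at this
      · simpa using h2
    rw [hf, hf0, hr0]
  · exact arcFace_eq_of_first_hit hpos h γ.nth_firstHit (γ.not_mem_hitIdx_of_lt_firstHit (by omega))

omit hr in
/-- No arc before the first crossing lies in `r`. [folklore] -/
theorem arcFace_ne_of_lt_firstHit {i : ℕ} (hi : i < γ.firstHit) (hi' : i < γ.arcs.length) :
    arcFace (γ.nth i, γ.nth (i + 1)) ≠ some r :=
  fun h => γ.not_mem_hitIdx_of_lt_firstHit hi (mem_hitIdx_of_arcFace hi' h).1

/-- The side through which the walk leaves `r` after its first arc in `r`. [folklore] -/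
def exitSide (h : γ.firstHit < γ.arcs.length) : Side :=
  Classical.choose (Classical.choose_spec (exists_sides_of_arcFace (γ.arcFace_firstHit hr h)))

/-- The mid-edge after the first hit is the exit side, which differs from the first side. [folklore] -/
theorem exitSide_spec (h : γ.firstHit < γ.arcs.length) :
    γ.nth (γ.firstHit + 1) = r.side (γ.exitSide hr h) ∧ γ.exitSide hr h ≠ γ.firstSide := by
  obtain ⟨hne, h1, h2, -⟩ := Classical.choose_spec (Classical.choose_spec (exists_sides_of_arcFace (γ.arcFace_firstHit hr h)))
  have e := r.side_injective (h1.trans γ.nth_firstHit)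
  exact ⟨h2.symm, fun h' => hne (e.trans h'.symm)⟩

/-- The exit index is a hit. [folklore] -/
theorem firstHit_succ_mem (h : γ.firstHit < γ.arcs.length) : γ.firstHit + 1 ∈ γ.hitIdx r :=
  (mem_hitIdx γ r).2 ⟨by omega, _, (γ.exitSide_spec hr h).1⟩

/-- The hits after the exit. [folklore] -/
def laterHits : Finset ℕ := (γ.hitIdx r).filter fun i => γ.firstHit + 1 < i

omit hr in
/-- Membership in the later hits. [folklore] -/
theorem mem_laterHits {i : ℕ} : i ∈ γ.laterHits ↔ i ∈ γ.hitIdx r ∧ γ.firstHit + 1 < i := Finset.mem_filter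

omit hr in
/-- A walk of class `B2` has a later hit. [folklore] -/
theorem laterHits_nonempty (h : γ.firstHit + 1 < γ.arcs.length) : γ.laterHits.Nonempty :=
  ⟨γ.arcs.length, (γ.mem_laterHits).2 ⟨γ.length_mem_hitIdx, h⟩⟩

/-- **The index of the return to `∂r`** after the excursion. [folklore] -/
def returnHit (h : γ.firstHit + 1 < γ.arcs.length) : ℕ := γ.laterHits.min' (γ.laterHits_nonempty h)

omit hr in
/-- The return index is a hit after the exit. [folklore] -/
theorem returnHit_mem (h : γ.firstHit + 1 < γ.arcs.length) : γ.returnHit h ∈ γ.hitIdx r ∧ γ.firstHit + 1 < γ.returnHit h :=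
  (γ.mem_laterHits).1 (Finset.min'_mem _ _)

omit hr in
/-- The return index is an index of the walk. [folklore] -/
theorem returnHit_le (h : γ.firstHit + 1 < γ.arcs.length) : γ.returnHit h ≤ γ.arcs.length :=
  ((mem_hitIdx γ r).1 (γ.returnHit_mem h).1).1

omit hr in
/-- No hit strictly between the exit and the return. [folklore] -/
theorem not_mem_hitIdx_of_between (h : γ.firstHit + 1 < γ.arcs.length) {i : ℕ} (h1 : γ.firstHit + 1 < i)
    (h2 : i < γ.returnHit h) : i ∉ γ.hitIdx r :=
  fun hi => (Finset.min'_le _ _ ((γ.mem_laterHits).2 ⟨hi, h1⟩)).not_gt h2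

/-- The side of `r` crossed at the return. [folklore] -/
def returnSide (h : γ.firstHit + 1 < γ.arcs.length) : Side :=
  Classical.choose ((mem_hitIdx γ r).1 (γ.returnHit_mem h).1).2

omit hr in
/-- The mid-edge at the return is the return side. [folklore] -/
theorem nth_returnHit (h : γ.firstHit + 1 < γ.arcs.length) : γ.nth (γ.returnHit h) = r.side (γ.returnSide h) :=
  Classical.choose_spec ((mem_hitIdx γ r).1 (γ.returnHit_mem h).1).2

/-- **The excursion stays outside `r`**: no arc strictly between the exit and the return lies in
`r`. [folklore] -/
theorem arcFace_ne_of_excursion (h : γ.firstHit + 1 < γ.arcs.length) {i : ℕ} (h1 : γ.firstHit < i)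
    (h2 : i < γ.returnHit h) : arcFace (γ.nth i, γ.nth (i + 1)) ≠ some r := by
  intro hin
  have hi : i < γ.arcs.length := lt_of_lt_of_le h2 (γ.returnHit_le h)
  obtain ⟨m1, m2⟩ := mem_hitIdx_of_arcFace hi hin
  -- `i` is a hit in `(firstHit, returnHit)`, hence `i = firstHit + 1`; then the arcs `firstHit` and
  -- `firstHit + 1` both lie in `r`
  rcases Nat.lt_or_ge (γ.firstHit + 1) i with hlt | hge
  · exact γ.not_mem_hitIdx_of_between h hlt h2 m1
  · have hi0 : i = γ.firstHit + 1 := by omega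
    subst hi0
    have := γ.chain_nth (i := γ.firstHit) (by omega)
    rw [γ.arcFace_firstHit hr (by omega), show γ.firstHit + 2 = γ.firstHit + 1 + 1 by ring, hin] at this
    exact this rfl

/-- The excursion has at least two arcs. [folklore] -/
theorem firstHit_add_three_le_returnHit (h : γ.firstHit + 1 < γ.arcs.length) : γ.firstHit + 3 ≤ γ.returnHit h := by
  by_contra hlt
  have heq : γ.returnHit h = γ.firstHit + 2 := by have := (γ.returnHit_mem h).2; omega
  -- then the arc `firstHit + 1` joins two sides of `r`, hence lies in `r`
  have e1 := (γ.exitSide_spec hr (by omega)).1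
  have e2 := γ.nth_returnHit h
  rw [heq] at e2
  have hst : γ.exitSide hr (by omega) ≠ γ.returnSide h := by
    intro hh
    have := γ.nth_inj (i := γ.firstHit + 1) (j := γ.firstHit + 2) (by omega) (by have := γ.returnHit_le h; omega)
      (by rw [e1, e2, hh])
    omega
  refine γ.arcFace_ne_of_excursion hr h (i := γ.firstHit + 1) (by omega) (by omega) ?_
  rw [e1, show γ.firstHit + 1 + 1 = γ.firstHit + 2 by ring, e2]
  exact arcFace_side_side r _ _ hst

/-- The sides at the first crossing, the exit and the return are distinct. [folklore] -/
theorem sides_distinct (h : γ.firstHit + 1 < γ.arcs.length) :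
    γ.exitSide hr (by omega) ≠ γ.firstSide ∧ γ.returnSide h ≠ γ.firstSide ∧ γ.returnSide h ≠ γ.exitSide hr (by omega) := by
  have hR := γ.returnHit_le h
  have hR' := (γ.returnHit_mem h).2
  refine ⟨(γ.exitSide_spec hr (by omega)).2, fun hh => ?_, fun hh => ?_⟩
  · have := γ.nth_inj (i := γ.returnHit h) (j := γ.firstHit) hR (by omega)
      (by rw [γ.nth_returnHit, γ.nth_firstHit, hh])
    omega
  · have := γ.nth_inj (i := γ.returnHit h) (j := γ.firstHit + 1) hR (by omega)
      (by rw [γ.nth_returnHit, (γ.exitSide_spec hr (by omega)).1, hh])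
    omega

/-- **The walk re-enters `r` at the return** (if it continues). [folklore] -/
theorem arcFace_returnHit (h : γ.firstHit + 1 < γ.arcs.length) (h' : γ.returnHit h < γ.arcs.length) :
    arcFace (γ.nth (γ.returnHit h), γ.nth (γ.returnHit h + 1)) = some r :=
  arcFace_eq_of_first_hit (by have := (γ.returnHit_mem h).2; omega) h' (γ.nth_returnHit h)
    (γ.not_mem_hitIdx_of_between h (by have := γ.firstHit_add_three_le_returnHit hr h; omega) (by
      have := (γ.returnHit_mem h).2; omega))

/-- The fourth side: where the walk leaves `r` after re-entering. [folklore] -/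
def fourthSide (h : γ.firstHit + 1 < γ.arcs.length) (h' : γ.returnHit h < γ.arcs.length) : Side :=
  Classical.choose (Classical.choose_spec (exists_sides_of_arcFace (γ.arcFace_returnHit hr h h')))

/-- The mid-edge after the return is the fourth side, which differs from the return side. [folklore] -/
theorem fourthSide_spec (h : γ.firstHit + 1 < γ.arcs.length) (h' : γ.returnHit h < γ.arcs.length) :
    γ.nth (γ.returnHit h + 1) = r.side (γ.fourthSide hr h h') ∧ γ.fourthSide hr h h' ≠ γ.returnSide h := by
  obtain ⟨hne, h1, h2, -⟩ :=
    Classical.choose_spec (Classical.choose_spec (exists_sides_of_arcFace (γ.arcFace_returnHit hr h h')))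
  have e := r.side_injective (h1.trans (γ.nth_returnHit h))
  exact ⟨h2.symm, fun h'' => hne (e.trans h''.symm)⟩

/-- **After re-entering, the walk stops at the fourth side**: all four sides are used. [folklore] -/
theorem returnHit_add_one_eq (h : γ.firstHit + 1 < γ.arcs.length) (h' : γ.returnHit h < γ.arcs.length) :
    γ.returnHit h + 1 = γ.arcs.length := by
  by_contra hne
  have hlt : γ.returnHit h + 1 < γ.arcs.length := by omega
  -- five hits with five distinct mid-edges on the four sides of `r`
  have hR' := (γ.returnHit_mem h).2
  let idx : Fin 5 → ℕ := ![γ.firstHit, γ.firstHit + 1, γ.returnHit h, γ.returnHit h + 1, γ.arcs.length]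
  let sd : Fin 5 → Side := ![γ.firstSide, γ.exitSide hr (by omega), γ.returnSide h, γ.fourthSide hr h h', sE]
  have hnth : ∀ m, γ.nth (idx m) = r.side (sd m) := by
    intro m
    fin_cases m
    · exact γ.nth_firstHit
    · exact (γ.exitSide_spec hr (by omega)).1
    · exact γ.nth_returnHit h
    · exact (γ.fourthSide_spec hr h h').1
    · exact γ.nth_length
  have hidx : Function.Injective idx := by
    intro m m' e
    fin_cases m <;> fin_cases m' <;> simp [idx] at e ⊢ <;> omega
  have hle : ∀ m, idx m ≤ γ.arcs.length := by
    intro m; fin_cases m <;> simp [idx] <;> omega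
  have hsd : Function.Injective sd := by
    intro m m' e
    apply hidx
    exact γ.nth_inj (hle m) (hle m') (by rw [hnth, hnth, e])
  have := Fintype.card_le_of_injective sd hsd
  simp [Fintype.card_fin] at this
  have h4 : Fintype.card Side = 4 := rfl
  omega

end Rect



end YBWalk



/-! ## The grouping argument (proof of Lemma 2.1 from the local relations and the excursion windings) -/

namespace YBWalk

section Prefix

variable {T L : ℕ} {r : Face} {sE sE' : Side} (γ : YBWalk (rect T L) origin (r.side sE))
  (δ : YBWalk (rect T L) origin (r.side sE'))

/-- Walks agreeing up to an index beyond the first hit of one of them have the same first hit.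
[folklore] -/
theorem firstHit_eq_of_agree {m : ℕ} (hmγ : m ≤ γ.arcs.length) (hmδ : m ≤ δ.arcs.length)
    (hagree : ∀ i ≤ m, δ.nth i = γ.nth i) (hfh : γ.firstHit ≤ m) : δ.firstHit = γ.firstHit := by
  have h1 : γ.firstHit ∈ δ.hitIdx r := by
    obtain ⟨-, s, hs⟩ := (mem_hitIdx γ r).1 γ.firstHit_mem
    exact (mem_hitIdx δ r).2 ⟨by omega, s, by rw [hagree _ hfh, hs]⟩
  have h2 := δ.firstHit_le_of_mem h1
  have h3 : δ.firstHit ∈ γ.hitIdx r := by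
    obtain ⟨-, s, hs⟩ := (mem_hitIdx δ r).1 δ.firstHit_mem
    exact (mem_hitIdx γ r).2 ⟨by omega, s, by rw [← hagree _ (by omega), hs]⟩
  have h4 := γ.firstHit_le_of_mem h3
  omega

/-- Walks agreeing beyond the first hit have the same first side. [folklore] -/
theorem firstSide_eq_of_agree {m : ℕ} (hmγ : m ≤ γ.arcs.length) (hmδ : m ≤ δ.arcs.length)
    (hagree : ∀ i ≤ m, δ.nth i = γ.nth i) (hfh : γ.firstHit ≤ m) : δ.firstSide = γ.firstSide := by
  have e := firstHit_eq_of_agree γ δ hmγ hmδ hagree hfh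
  apply r.side_injective
  rw [← γ.nth_firstHit, ← δ.nth_firstHit, e, hagree _ hfh]

/-- Walks agreeing beyond the exit have the same exit side. [folklore] -/
theorem exitSide_eq_of_agree (hr : r ∈ rect T L) {m : ℕ} (hmγ : m ≤ γ.arcs.length) (hmδ : m ≤ δ.arcs.length)
    (hagree : ∀ i ≤ m, δ.nth i = γ.nth i) (hfh : γ.firstHit + 1 ≤ m) (hγ : γ.firstHit < γ.arcs.length)
    (hδ : δ.firstHit < δ.arcs.length) : δ.exitSide hr hδ = γ.exitSide hr hγ := by
  have e := firstHit_eq_of_agree γ δ hmγ hmδ hagree (by omega)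
  apply r.side_injective
  rw [← (γ.exitSide_spec hr hγ).1, ← (δ.exitSide_spec hr hδ).1, e, hagree _ hfh]

/-- Walks agreeing beyond the return have the same return index. [folklore] -/
theorem returnHit_eq_of_agree {m : ℕ} (hmγ : m ≤ γ.arcs.length) (hmδ : m ≤ δ.arcs.length)
    (hagree : ∀ i ≤ m, δ.nth i = γ.nth i) (hγ : γ.firstHit + 1 < γ.arcs.length)
    (hδ : δ.firstHit + 1 < δ.arcs.length) (hrh : γ.returnHit hγ ≤ m) : δ.returnHit hδ = γ.returnHit hγ := by
  have e := firstHit_eq_of_agree γ δ hmγ hmδ hagree (by have := (γ.returnHit_mem hγ).2; omega)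
  obtain ⟨hmem, hgt⟩ := γ.returnHit_mem hγ
  have h1 : γ.returnHit hγ ∈ δ.laterHits := by
    obtain ⟨-, s, hs⟩ := (mem_hitIdx γ r).1 hmem
    exact (δ.mem_laterHits).2 ⟨(mem_hitIdx δ r).2 ⟨by omega, s, by rw [hagree _ hrh, hs]⟩, by omega⟩
  have h2 : δ.returnHit hδ ≤ γ.returnHit hγ := Finset.min'_le _ _ h1
  obtain ⟨hmem', hgt'⟩ := δ.returnHit_mem hδ
  have h3 : δ.returnHit hδ ∈ γ.laterHits := by
    obtain ⟨-, s, hs⟩ := (mem_hitIdx δ r).1 hmem'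
    exact (γ.mem_laterHits).2 ⟨(mem_hitIdx γ r).2 ⟨by omega, s, by rw [← hagree _ (by omega), hs]⟩, by omega⟩
  have h4 : γ.returnHit hγ ≤ δ.returnHit hδ := Finset.min'_le _ _ h3
  omega

/-- Walks agreeing beyond the return have the same return side. [folklore] -/
theorem returnSide_eq_of_agree {m : ℕ} (hmγ : m ≤ γ.arcs.length) (hmδ : m ≤ δ.arcs.length)
    (hagree : ∀ i ≤ m, δ.nth i = γ.nth i) (hγ : γ.firstHit + 1 < γ.arcs.length)
    (hδ : δ.firstHit + 1 < δ.arcs.length) (hrh : γ.returnHit hγ ≤ m) : δ.returnSide hδ = γ.returnSide hγ := by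
  have e := returnHit_eq_of_agree γ δ hmγ hmδ hagree hγ hδ hrh
  apply r.side_injective
  rw [← γ.nth_returnHit, ← δ.nth_returnHit, e, hagree _ hrh]

end Prefix

end YBWalk

/-- Four distinct sides: if one pair is straight, so is the complementary pair, and the two are
the two crossing straight arcs. [folklore] -/
theorem straight_compl {a b c d : Side}
    (hab : a ≠ b) (hac : a ≠ c) (had : a ≠ d) (hbc : b ≠ c) (hbd : b ≠ d) (hcd : c ≠ d)
    (h : arcKind a b = .straight) (f : Face) :
    (IsWE f (f.side a, f.side b) ∧ IsSN f (f.side c, f.side d)) ∨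
      (IsSN f (f.side a, f.side b) ∧ IsWE f (f.side c, f.side d)) := by
  unfold IsWE IsSN
  simp only [Prod.mk.injEq, f.side_injective.eq_iff]
  revert hab hac had hbc hbd hcd h
  cases a <;> cases b <;> cases c <;> cases d <;> decide

/-! ### The local relations in general position -/

/-- The bracket of the second group: the four members of the group of an excursion. [folklore] -/
def bracket (θ : ℝ) (z₀ z₁ z₂ z₃ : Side) (X : ℝ) : ℂ :=
  crCoef θ z₂ * (arcWeight θ z₀ z₁ : ℂ) * phase (arcTurn θ z₀ z₁ + X) +
  crCoef θ z₃ * (pairWeight θ z₀ z₁ z₂ z₃ : ℂ) * phase (arcTurn θ z₀ z₁ + X + arcTurn θ z₂ z₃) +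
  crCoef θ z₁ * (arcWeight θ z₀ z₂ : ℂ) * phase (arcTurn θ z₀ z₂ - X) +
  crCoef θ z₃ * (pairWeight θ z₀ z₂ z₁ z₃ : ℂ) * phase (arcTurn θ z₀ z₂ - X + arcTurn θ z₁ z₃)

/-- The bracket is symmetric under reversal of the excursion. [folklore] -/
theorem bracket_swap (θ : ℝ) (z₀ z₁ z₂ z₃ : Side) (X : ℝ) :
    bracket θ z₀ z₂ z₁ z₃ (-X) = bracket θ z₀ z₁ z₂ z₃ X := by
  simp only [bracket, sub_neg_eq_add, ← sub_eq_add_neg]; ring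

/-- **The second local relation in general position**: for the four sides `z₀, z₁, z₂, z₃` of a
rhombus, the bracket of the group of an excursion from `z₁` to `z₂` (first visit at `z₀`) with
the tabulated winding vanishes. [cite: GlazmanManolescu2019, Lemma 2.1 (proof: [Gl], Lemma 3.1)] -/
theorem groupTwo_gen (θ : ℝ) (z₀ z₁ z₂ z₃ : Side) (h01 : z₀ ≠ z₁) (h02 : z₀ ≠ z₂) (h03 : z₀ ≠ z₃)
    (h12 : z₁ ≠ z₂) (h13 : z₁ ≠ z₃) (h23 : z₂ ≠ z₃) :
    bracket θ z₀ z₁ z₂ z₃ (excursionWinding θ z₀ z₁ z₂) = 0 := by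
  revert h01 h02 h03 h12 h13 h23
  cases z₀ <;> cases z₁ <;> cases z₂ <;> cases z₃ <;> intro h01 h02 h03 h12 h13 h23 <;>
    (try exact absurd rfl h01) <;> (try exact absurd rfl h02) <;> (try exact absurd rfl h03) <;>
    (try exact absurd rfl h12) <;> (try exact absurd rfl h13) <;> (try exact absurd rfl h23)
  · -- W E S
    unfold bracket; exact groupTwo_W_E_S θ
  · -- W E N (reversed)
    rw [← bracket_swap, excursionWinding_swap θ .W .N .E, neg_neg]
    unfold bracket; exact groupTwo_W_N_E θ
  · -- W S E (reversed)
    rw [← bracket_swap, excursionWinding_swap θ .W .E .S, neg_neg]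
    unfold bracket; exact groupTwo_W_E_S θ
  · -- W S N (reversed)
    rw [← bracket_swap, excursionWinding_swap θ .W .N .S, neg_neg]
    unfold bracket; exact groupTwo_W_N_S θ
  · -- W N E
    unfold bracket; exact groupTwo_W_N_E θ
  · -- W N S
    unfold bracket; exact groupTwo_W_N_S θ
  · -- E W S
    unfold bracket; exact groupTwo_E_W_S θ
  · -- E W N
    unfold bracket; exact groupTwo_E_W_N θ
  · -- E S W (reversed)
    rw [← bracket_swap, excursionWinding_swap θ .E .W .S, neg_neg]
    unfold bracket; exact groupTwo_E_W_S θ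
  · -- E S N (reversed)
    rw [← bracket_swap, excursionWinding_swap θ .E .N .S, neg_neg]
    unfold bracket; exact groupTwo_E_N_S θ
  · -- E N W (reversed)
    rw [← bracket_swap, excursionWinding_swap θ .E .W .N, neg_neg]
    unfold bracket; exact groupTwo_E_W_N θ
  · -- E N S
    unfold bracket; exact groupTwo_E_N_S θ
  · -- S W E
    unfold bracket; exact groupTwo_S_W_E θ
  · -- S W N
    unfold bracket; exact groupTwo_S_W_N θ
  · -- S E W (reversed)
    rw [← bracket_swap, excursionWinding_swap θ .S .W .E, neg_neg]
    unfold bracket; exact groupTwo_S_W_E θ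
  · -- S E N (reversed)
    rw [← bracket_swap, excursionWinding_swap θ .S .N .E, neg_neg]
    unfold bracket; exact groupTwo_S_N_E θ
  · -- S N W (reversed)
    rw [← bracket_swap, excursionWinding_swap θ .S .W .N, neg_neg]
    unfold bracket; exact groupTwo_S_W_N θ
  · -- S N E
    unfold bracket; exact groupTwo_S_N_E θ
  · -- N W E
    unfold bracket; exact groupTwo_N_W_E θ
  · -- N W S
    unfold bracket; exact groupTwo_N_W_S θ
  · -- N E W (reversed)
    rw [← bracket_swap, excursionWinding_swap θ .N .W .E, neg_neg]
    unfold bracket; exact groupTwo_N_W_E θ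
  · -- N E S
    unfold bracket; exact groupTwo_N_E_S θ
  · -- N S W (reversed)
    rw [← bracket_swap, excursionWinding_swap θ .N .W .S, neg_neg]
    unfold bracket; exact groupTwo_N_W_S θ
  · -- N S E (reversed)
    rw [← bracket_swap, excursionWinding_swap θ .N .E .S, neg_neg]
    unfold bracket; exact groupTwo_N_E_S θ

/-- **The first local relation in general position.** [cite: GlazmanManolescu2019, Lemma 2.1 (proof: [Gl], Lemma 3.1)] -/
theorem groupOne_gen (θ : ℝ) (hθ : weightDen θ ≠ 0) (z₀ : Side) :
    crCoef θ z₀ + ∑ z₁ ∈ Finset.univ.erase z₀, crCoef θ z₁ * (arcWeight θ z₀ z₁ : ℂ) * phase (arcTurn θ z₀ z₁) = 0 := by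
  have hs : ∀ a b c : Side, a ≠ b → a ≠ c → b ≠ c → ∀ F : Side → ℂ,
      ∑ x ∈ ({a, b, c} : Finset Side), F x = F a + F b + F c := by
    intro a b c hab hac hbc F
    rw [Finset.sum_insert (by simp [hab, hac]), Finset.sum_insert (by simp [hbc]), Finset.sum_singleton, add_assoc]
  cases z₀
  · rw [show (Finset.univ : Finset Side).erase .W = {Side.N, Side.E, Side.S} from by decide,
      hs _ _ _ (by decide) (by decide) (by decide)]
    linear_combination groupOne_W θ hθ
  · rw [show (Finset.univ : Finset Side).erase .E = {Side.W, Side.N, Side.S} from by decide,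
      hs _ _ _ (by decide) (by decide) (by decide)]
    linear_combination groupOne_E θ hθ
  · rw [show (Finset.univ : Finset Side).erase .S = {Side.W, Side.N, Side.E} from by decide,
      hs _ _ _ (by decide) (by decide) (by decide)]
    linear_combination groupOne_S θ hθ
  · rw [show (Finset.univ : Finset Side).erase .N = {Side.W, Side.E, Side.S} from by decide,
      hs _ _ _ (by decide) (by decide) (by decide)]
    linear_combination groupOne_N θ hθ

/-- A straight arc together with another arc has weight `0`. [folklore] -/
theorem localWeight_straight_cons (θ : ℝ) (κ : ArcKind) : localWeight θ [.straight, κ] = 0 := by cases κ <;> rfl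

section CR

open Classical

variable {T L : ℕ} {r : Face}

/-- The walks from the origin ending on a side of `r`, labelled by that side. [folklore] -/
abbrev Ω (T L : ℕ) (r : Face) : Type := Σ s : Side, YBWalk (rect T L) origin (r.side s)

namespace Ω

variable (ω : Ω T L r)

/-- The walk `ω` stops at its first crossing of `∂r` (class `A`; a predicate on labelled walks, the
walk being an explicit argument). [folklore] -/
def IsA (ω : Ω T L r) : Prop := ω.2.firstHit = ω.2.arcs.length

/-- The walk `ω` stops right after its first arc in `r` (class `B1`; a predicate on labelled walks).
[folklore] -/
def IsB1 (ω : Ω T L r) : Prop := ω.2.firstHit + 1 = ω.2.arcs.length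

/-- The walk `ω` continues after its first arc in `r` (class `B2`; a predicate on labelled walks).
[folklore] -/
def IsB2 (ω : Ω T L r) : Prop := ω.2.firstHit + 1 < ω.2.arcs.length

/-- The three classes exhaust the walks ending on `∂r`. [folklore] -/
theorem isA_or : ω.IsA ∨ ω.IsB1 ∨ ω.IsB2 := by
  have := ω.2.firstHit_le; unfold IsA IsB1 IsB2; omega

/-- A walk of class `A` first crosses `∂r` at its end. [folklore] -/
theorem firstSide_of_isA (h : ω.IsA) : ω.2.firstSide = ω.1 := by
  apply r.side_injective
  rw [← ω.2.nth_firstHit, show ω.2.firstHit = ω.2.arcs.length from h, ω.2.nth_length]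

/-- A walk of class `A` has no arc in `r` and crosses `∂r` only at its end. [folklore] -/
theorem nth_ne_side_of_isA (h : ω.IsA) {i : ℕ} (hi : i < ω.2.arcs.length) (s : Side) : ω.2.nth i ≠ r.side s := by
  intro e
  have := ω.2.firstHit_le_of_mem ((YBWalk.mem_hitIdx _ r).2 ⟨hi.le, s, e⟩)
  unfold IsA at h; omega

/-- A walk of class `A` has no arc in `r`. [folklore] -/
theorem arcFace_ne_of_isA (h : ω.IsA) {i : ℕ} (hi : i < ω.2.arcs.length) :
    arcFace (ω.2.nth i, ω.2.nth (i + 1)) ≠ some r :=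
  ω.2.arcFace_ne_of_lt_firstHit (by unfold IsA at h; omega) hi

/-- **Extension of a walk of class `A` by an arc of `r`** to the side `z₁` (junk: `ω` itself when
not applicable). [folklore] -/
def extA (hr : r ∈ rect T L) (z₁ : Side) : Ω T L r :=
  if h : ω.IsA ∧ z₁ ≠ ω.1 then
    ⟨z₁, ω.2.snoc (r.side z₁) r (arcFace_side_side r ω.1 z₁ (Ne.symm h.2)) hr
      (by
        rw [ω.2.mem_mids_iff_nth]
        rintro ⟨i, hi, e⟩
        rcases hi.lt_or_eq with hi | rfl
        · exact ω.nth_ne_side_of_isA h.1 hi z₁ e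
        · rw [ω.2.nth_length] at e; exact h.2 (r.side_injective e).symm)
      (by
        intro i hi e
        have := ω.arcFace_ne_of_isA h.1 (i := i) (by omega)
        rw [hi, ω.2.nth_length] at this
        exact this e)
      (fun _ i hi hSN => ω.arcFace_ne_of_isA h.1 hi (arcFace_of_isSN hSN))
      (fun _ i hi hWE => ω.arcFace_ne_of_isA h.1 hi (arcFace_of_isWE hWE))⟩
  else ω

/-- The label of the one-arc extension. [folklore] -/
theorem extA_fst (hr : r ∈ rect T L) {z₁ : Side} (h : ω.IsA) (hz : z₁ ≠ ω.1) : (ω.extA hr z₁).1 = z₁ := by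
  rw [extA, dif_pos ⟨h, hz⟩]

/-- The arcs of the one-arc extension. [folklore] -/
theorem extA_snd_arcs (hr : r ∈ rect T L) {z₁ : Side} (h : ω.IsA) (hz : z₁ ≠ ω.1) :
    (ω.extA hr z₁).2.arcs = ω.2.arcs ++ [(r.side ω.1, r.side z₁)] := by
  rw [extA, dif_pos ⟨h, hz⟩]; dsimp only; apply YBWalk.snoc_arcs

/-- The one-arc extension has one more arc. [folklore] -/
theorem extA_snd_length (hr : r ∈ rect T L) {z₁ : Side} (h : ω.IsA) (hz : z₁ ≠ ω.1) :
    (ω.extA hr z₁).2.arcs.length = ω.2.arcs.length + 1 := by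
  rw [ω.extA_snd_arcs hr h hz, List.length_append, List.length_singleton]

/-- The one-arc extension agrees with the walk. [folklore] -/
theorem extA_snd_nth (hr : r ∈ rect T L) {z₁ : Side} (h : ω.IsA) (hz : z₁ ≠ ω.1) {i : ℕ} (hi : i ≤ ω.2.arcs.length) :
    (ω.extA hr z₁).2.nth i = ω.2.nth i := by
  rw [extA, dif_pos ⟨h, hz⟩]; dsimp only; apply YBWalk.snoc_nth; exact hi

/-- The one-arc extension is of class `B1`. [folklore] -/
theorem extA_isB1 (hr : r ∈ rect T L) {z₁ : Side} (h : ω.IsA) (hz : z₁ ≠ ω.1) : (ω.extA hr z₁).IsB1 := by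
  unfold IsB1
  rw [YBWalk.firstHit_eq_of_agree ω.2 (ω.extA hr z₁).2 le_rfl (by rw [ω.extA_snd_length hr h hz]; omega)
    (fun i hi => ω.extA_snd_nth hr h hz hi) ω.2.firstHit_le, ω.extA_snd_length hr h hz]
  unfold IsA at h; omega

/-- Two labelled walks with the same label and the same mid-edges are equal. [folklore] -/
theorem ext_of_mids {ω ω' : Ω T L r} (h1 : ω.1 = ω'.1) (h2 : ω.2.mids = ω'.2.mids) : ω = ω' := by
  obtain ⟨s, γ⟩ := ω
  obtain ⟨s', γ'⟩ := ω'
  simp only at h1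
  subst h1
  simp only [Sigma.mk.injEq, heq_eq_eq, true_and]
  exact YBWalk.ext h2

/-- Walks of the same length with the same `nth` have the same mid-edges. [folklore] -/
theorem _root_.Literature.Probability.RandomPlanarGeometry.SAW.YangBaxter.YBWalk.mids_ext_nth {D : Set Face} {a z z' : MidEdge}
    (γ : YBWalk D a z) (δ : YBWalk D a z') (hl : δ.arcs.length = γ.arcs.length)
    (h : ∀ i ≤ γ.arcs.length, δ.nth i = γ.nth i) : δ.mids = γ.mids := by
  apply List.ext_getElem
  · rw [δ.length_eq, γ.length_eq, hl]
  · intro i h1 h2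
    rw [← δ.nth_eq_getElem, ← γ.nth_eq_getElem]
    exact h i (by rw [γ.length_eq] at h2; omega)

/-- A walk of class `B1` ends at its exit side. [folklore] -/
theorem exitSide_of_isB1 (hr : r ∈ rect T L) (h : ω.IsB1) : ω.2.exitSide hr (by unfold IsB1 at h; omega) = ω.1 := by
  apply r.side_injective
  rw [← (ω.2.exitSide_spec hr _).1, show ω.2.firstHit + 1 = ω.2.arcs.length from h, ω.2.nth_length]

/-- The first side of a walk of class `B1` is not its end. [folklore] -/
theorem firstSide_ne_of_isB1 (hr : r ∈ rect T L) (h : ω.IsB1) : ω.2.firstSide ≠ ω.1 := by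
  have h2 := (ω.2.exitSide_spec hr (by unfold IsB1 at h; omega)).2
  rw [ω.exitSide_of_isB1 hr h] at h2
  exact h2.symm

/-- **The walk of class `A` under a walk of class `B1`**: drop the last arc. [folklore] -/
def baseA : Ω T L r :=
  if h : ω.IsB1 then
    ⟨ω.2.firstSide, (ω.2.dropLast (by unfold IsB1 at h; omega)).cast rfl (by
      rw [← ω.2.nth_firstHit]; congr 1; unfold IsB1 at h; omega)⟩
  else ω

/-- The label of the base walk. [folklore] -/
theorem baseA_fst (h : ω.IsB1) : (ω.baseA).1 = ω.2.firstSide := by rw [baseA, dif_pos h]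

/-- The base walk has one arc less. [folklore] -/
theorem baseA_snd_length (h : ω.IsB1) : (ω.baseA).2.arcs.length = ω.2.arcs.length - 1 := by
  rw [baseA, dif_pos h]; dsimp only
  rw [YBWalk.length_arcs, YBWalk.cast_mids, ← YBWalk.length_arcs]; apply YBWalk.dropLast_length

/-- The base walk agrees with the walk. [folklore] -/
theorem baseA_snd_nth (h : ω.IsB1) {i : ℕ} (hi : i ≤ ω.2.arcs.length - 1) : (ω.baseA).2.nth i = ω.2.nth i := by
  rw [baseA, dif_pos h]; dsimp only
  rw [YBWalk.nth, YBWalk.cast_mids, ← YBWalk.nth]; apply YBWalk.dropLast_nth; exact hi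

/-- The base walk is of class `A`. [folklore] -/
theorem baseA_isA (h : ω.IsB1) : (ω.baseA).IsA := by
  unfold IsA
  rw [YBWalk.firstHit_eq_of_agree ω.2 (ω.baseA).2 (m := ω.2.arcs.length - 1) (by omega)
    (by rw [ω.baseA_snd_length h]) (fun i hi => ω.baseA_snd_nth h hi) (by unfold IsB1 at h; omega),
    ω.baseA_snd_length h]
  unfold IsB1 at h; omega

/-- Extending the base walk gives back the walk. [folklore] -/
theorem extA_baseA (hr : r ∈ rect T L) (h : ω.IsB1) : (ω.baseA).extA hr ω.1 = ω := by
  have hA := ω.baseA_isA h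
  have hz : ω.1 ≠ (ω.baseA).1 := by rw [ω.baseA_fst h]; exact (ω.firstSide_ne_of_isB1 hr h).symm
  apply ext_of_mids
  · exact (ω.baseA).extA_fst hr hA hz
  · apply YBWalk.mids_ext_nth
    · rw [(ω.baseA).extA_snd_length hr hA hz, ω.baseA_snd_length h]; unfold IsB1 at h; omega
    · intro i hi
      rcases hi.lt_or_eq with hi | rfl
      · rw [(ω.baseA).extA_snd_nth hr hA hz (by rw [ω.baseA_snd_length h]; omega),
          ω.baseA_snd_nth h (by omega)]
      · have hlen : ((ω.baseA).extA hr ω.1).2.arcs.length = ω.2.arcs.length := by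
          rw [(ω.baseA).extA_snd_length hr hA hz, ω.baseA_snd_length h]; unfold IsB1 at h; omega
        have e1 := ((ω.baseA).extA hr ω.1).2.nth_length
        rw [hlen] at e1
        exact (e1.trans (congrArg r.side ((ω.baseA).extA_fst hr hA hz))).trans ω.2.nth_length.symm

/-- The base of the extension is the walk. [folklore] -/
theorem baseA_extA (hr : r ∈ rect T L) {z₁ : Side} (h : ω.IsA) (hz : z₁ ≠ ω.1) : (ω.extA hr z₁).baseA = ω := by
  have hB := ω.extA_isB1 hr h hz
  apply ext_of_mids
  · rw [(ω.extA hr z₁).baseA_fst hB, YBWalk.firstSide_eq_of_agree ω.2 (ω.extA hr z₁).2 le_rfl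
      (by rw [ω.extA_snd_length hr h hz]; omega) (fun i hi => ω.extA_snd_nth hr h hz hi) ω.2.firstHit_le,
      ω.firstSide_of_isA h]
  · apply YBWalk.mids_ext_nth
    · rw [(ω.extA hr z₁).baseA_snd_length hB, ω.extA_snd_length hr h hz]; rfl
    · intro i hi
      rw [(ω.extA hr z₁).baseA_snd_nth hB (by rw [ω.extA_snd_length hr h hz]; omega), ω.extA_snd_nth hr h hz hi]

/-! #### Class `B2`: the excursion, the return, the involution -/

/-- The walk `ω` returns to `∂r` and stops there (class `B2a`; a predicate on labelled walks — e.g. the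
trivial walk is of class `A`, not `B2a`). [folklore] -/
def IsB2a (ω : Ω T L r) : Prop := ∃ h : ω.IsB2, ω.2.returnHit h = ω.2.arcs.length

/-- The walk `ω` returns to `∂r`, re-enters `r` and stops at the fourth side (class `B2b`; a predicate
on labelled walks). [folklore] -/
def IsB2b (ω : Ω T L r) : Prop := ∃ h : ω.IsB2, ω.2.returnHit h < ω.2.arcs.length

/-- Class `B2` splits into `B2a` and `B2b`. [folklore] -/
theorem isB2a_or (h : ω.IsB2) : ω.IsB2a ∨ ω.IsB2b := by
  have := ω.2.returnHit_le h
  rcases this.lt_or_eq with h' | h'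
  · exact Or.inr ⟨h, h'⟩
  · exact Or.inl ⟨h, h'⟩

/-- A walk of class `B2a` ends at its return side. [folklore] -/
theorem returnSide_of_isB2a (h : ω.IsB2a) : ω.2.returnSide h.1 = ω.1 := by
  apply r.side_injective
  rw [← ω.2.nth_returnHit h.1, h.2, ω.2.nth_length]

/-- In class `B2a`, the only arc in `r` is the first one. [folklore] -/
theorem arcFace_ne_of_isB2a (hr : r ∈ rect T L) (h : ω.IsB2a) {i : ℕ} (hi : i < ω.2.arcs.length) (hne : i ≠ ω.2.firstHit) :
    arcFace (ω.2.nth i, ω.2.nth (i + 1)) ≠ some r := by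
  rcases Nat.lt_or_gt_of_ne hne with hlt | hgt
  · exact ω.2.arcFace_ne_of_lt_firstHit hlt hi
  · exact ω.2.arcFace_ne_of_excursion hr h.1 hgt (by rw [h.2]; exact hi)

/-- In class `B2a`, `r` carries exactly the first arc. [folklore] -/
theorem kindsIn_of_isB2a (hr : r ∈ rect T L) (h : ω.IsB2a) :
    ω.2.kindsIn r = [arcKind ω.2.firstSide (ω.2.exitSide hr (by have := h.1; unfold IsB2 at this; omega))] := by
  have hfh : ω.2.firstHit < ω.2.arcs.length := by have := h.1; unfold IsB2 at this; omega
  rw [YBWalk.kindsIn_eq]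
  -- split the arcs at the first hit
  conv_lhs => rw [YBWalk.list_eq_take_cons_drop ω.2.arcs hfh, List.filterMap_append, List.filterMap_append]
  have h0 : ∀ p ∈ ω.2.arcs.take ω.2.firstHit ++ ω.2.arcs.drop (ω.2.firstHit + 1), kindF r p = none := by
    intro p hp
    rw [List.mem_append] at hp
    rcases hp with hp | hp
    · obtain ⟨i, hi, rfl⟩ := List.mem_iff_getElem.1 hp
      rw [List.length_take] at hi
      rw [List.getElem_take, ω.2.arcs_getElem_eq_nth (by omega)]
      exact kindF_of_ne (ω.arcFace_ne_of_isB2a hr h (by omega) (by omega))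
    · obtain ⟨i, hi, rfl⟩ := List.mem_iff_getElem.1 hp
      rw [List.length_drop] at hi
      rw [List.getElem_drop, ω.2.arcs_getElem_eq_nth (by omega)]
      exact kindF_of_ne (ω.arcFace_ne_of_isB2a hr h (by omega) (by omega))
  rw [List.filterMap_eq_nil_iff.2 fun p hp => h0 p (List.mem_append_left _ hp),
    List.filterMap_eq_nil_iff.2 fun p hp => h0 p (List.mem_append_right _ hp),
    ω.2.arcs_getElem_eq_nth hfh, ω.2.nth_firstHit, (ω.2.exitSide_spec hr hfh).1]
  simp [kindF_side_side r (ω.2.exitSide_spec hr hfh).2.symm]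

/-- **The involution**: reverse the part of the walk after its first crossing of `∂r`. [folklore] -/
def rev (hr : r ∈ rect T L) : Ω T L r :=
  if h : ω.IsB2a then
    ⟨ω.2.exitSide hr (by have := h.1; unfold IsB2 at this; omega),
      (ω.2.revSuffix ω.2.firstHit (by have := h.1; unfold IsB2 at this; omega) r
        (by
          rw [ω.2.nth_firstHit]
          refine arcFace_side_side r _ _ fun e => ?_
          have := (ω.2.sides_distinct hr h.1).2.1
          rw [ω.returnSide_of_isB2a h] at this
          exact this e.symm)
        hr (fun i hi hne => ω.arcFace_ne_of_isB2a hr h hi hne)).cast rfl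
        (ω.2.exitSide_spec hr _).1⟩
  else ω

/-- The reversed walk ends at the exit side. [folklore] -/
theorem rev_fst (hr : r ∈ rect T L) (h : ω.IsB2a) : (ω.rev hr).1 = ω.2.exitSide hr (by have := h.1; unfold IsB2 at this; omega) := by
  rw [rev, dif_pos h]

/-- Reversal keeps the number of arcs. [folklore] -/
theorem rev_snd_length (hr : r ∈ rect T L) (h : ω.IsB2a) : (ω.rev hr).2.arcs.length = ω.2.arcs.length := by
  rw [rev, dif_pos h]; dsimp only
  rw [YBWalk.length_arcs, YBWalk.cast_mids, ← YBWalk.length_arcs]; apply YBWalk.revSuffix_length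

/-- `nth` of the reversed walk. [folklore] -/
theorem rev_snd_nth (hr : r ∈ rect T L) (h : ω.IsB2a) {i : ℕ} (hi : i ≤ ω.2.arcs.length) :
    (ω.rev hr).2.nth i = if i ≤ ω.2.firstHit then ω.2.nth i else ω.2.nth (ω.2.arcs.length + ω.2.firstHit + 1 - i) := by
  rw [rev, dif_pos h]; dsimp only
  rw [YBWalk.nth, YBWalk.cast_mids, ← YBWalk.nth]; apply YBWalk.revSuffix_nth; exact hi

/-- The arcs of the reversed walk. [folklore] -/
theorem rev_snd_arcs (hr : r ∈ rect T L) (h : ω.IsB2a) :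
    (ω.rev hr).2.arcs = ω.2.arcs.take ω.2.firstHit ++ [(ω.2.nth ω.2.firstHit, r.side ω.1)] ++
      ((ω.2.arcs.drop (ω.2.firstHit + 1)).reverse.map Prod.swap) := by
  rw [rev, dif_pos h]; dsimp only
  rw [YBWalk.arcs, YBWalk.cast_mids, ← YBWalk.arcs]; apply YBWalk.revSuffix_arcs

/-- Reversal has no fixed point. [folklore] -/
theorem rev_ne (hr : r ∈ rect T L) (h : ω.IsB2a) : ω.rev hr ≠ ω := by
  intro e
  have h1 := congrArg Sigma.fst e
  rw [ω.rev_fst hr h] at h1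
  have := (ω.2.sides_distinct hr h.1).2.2
  rw [ω.returnSide_of_isB2a h] at this
  exact this h1.symm

/-- Reversal keeps the first hit. [folklore] -/
theorem rev_firstHit (hr : r ∈ rect T L) (h : ω.IsB2a) : (ω.rev hr).2.firstHit = ω.2.firstHit :=
  YBWalk.firstHit_eq_of_agree ω.2 (ω.rev hr).2 (m := ω.2.firstHit) ω.2.firstHit_le
    (by rw [ω.rev_snd_length hr h]; exact ω.2.firstHit_le)
    (fun i hi => by rw [ω.rev_snd_nth hr h (hi.trans ω.2.firstHit_le), if_pos hi]) le_rfl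

/-- Reversal keeps the first side. [folklore] -/
theorem rev_firstSide (hr : r ∈ rect T L) (h : ω.IsB2a) : (ω.rev hr).2.firstSide = ω.2.firstSide :=
  YBWalk.firstSide_eq_of_agree ω.2 (ω.rev hr).2 (m := ω.2.firstHit) ω.2.firstHit_le
    (by rw [ω.rev_snd_length hr h]; exact ω.2.firstHit_le)
    (fun i hi => by rw [ω.rev_snd_nth hr h (hi.trans ω.2.firstHit_le), if_pos hi]) le_rfl

/-- The reversed walk is of class `B2`. [folklore] -/
theorem rev_isB2 (hr : r ∈ rect T L) (h : ω.IsB2a) : (ω.rev hr).IsB2 := by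
  unfold IsB2; rw [ω.rev_firstHit hr h, ω.rev_snd_length hr h]; exact h.1

/-- The reversed walk returns to `∂r` only at its end. [folklore] -/
theorem rev_returnHit (hr : r ∈ rect T L) (h : ω.IsB2a) : (ω.rev hr).2.returnHit (ω.rev_isB2 hr h) = (ω.rev hr).2.arcs.length := by
  have hB := ω.rev_isB2 hr h
  apply le_antisymm ((ω.rev hr).2.returnHit_le _)
  by_contra hlt
  push Not at hlt
  obtain ⟨hmem, hgt⟩ := (ω.rev hr).2.returnHit_mem hB
  rw [ω.rev_firstHit hr h] at hgt
  rw [ω.rev_snd_length hr h] at hlt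
  obtain ⟨-, s, hs⟩ := (YBWalk.mem_hitIdx _ r).1 hmem
  rw [ω.rev_snd_nth hr h hlt.le, if_neg (by omega)] at hs
  -- an interior index of the excursion would be a hit of `ω`
  have hi : ω.2.firstHit + 1 < ω.2.arcs.length + ω.2.firstHit + 1 - (ω.rev hr).2.returnHit hB := by omega
  have hi' : ω.2.arcs.length + ω.2.firstHit + 1 - (ω.rev hr).2.returnHit hB < ω.2.returnHit h.1 := by
    rw [h.2]; omega
  exact ω.2.not_mem_hitIdx_of_between h.1 hi hi' ((YBWalk.mem_hitIdx _ r).2 ⟨by omega, s, hs⟩)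

/-- The reversed walk is of class `B2a`. [folklore] -/
theorem rev_isB2a (hr : r ∈ rect T L) (h : ω.IsB2a) : (ω.rev hr).IsB2a := ⟨ω.rev_isB2 hr h, ω.rev_returnHit hr h⟩

/-- The exit side of the reversed walk is the return side. [folklore] -/
theorem rev_exitSide (hr : r ∈ rect T L) (h : ω.IsB2a) :
    (ω.rev hr).2.exitSide hr (by have := (ω.rev_isB2 hr h); unfold IsB2 at this; omega) = ω.1 := by
  apply r.side_injective
  rw [← ((ω.rev hr).2.exitSide_spec hr _).1, ω.rev_firstHit hr h,
    ω.rev_snd_nth hr h (by have := h.1; unfold IsB2 at this; omega), if_neg (by omega),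
    show ω.2.arcs.length + ω.2.firstHit + 1 - (ω.2.firstHit + 1) = ω.2.arcs.length by omega, ω.2.nth_length]

/-- **Reversal is an involution.** [folklore] -/
theorem rev_rev (hr : r ∈ rect T L) (h : ω.IsB2a) : (ω.rev hr).rev hr = ω := by
  have h' := ω.rev_isB2a hr h
  apply ext_of_mids
  · rw [(ω.rev hr).rev_fst hr h', ω.rev_exitSide hr h]
  · apply YBWalk.mids_ext_nth
    · rw [(ω.rev hr).rev_snd_length hr h', ω.rev_snd_length hr h]
    · intro i hi
      rw [(ω.rev hr).rev_snd_nth hr h' (by rw [ω.rev_snd_length hr h]; exact hi), ω.rev_firstHit hr h,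
        ω.rev_snd_length hr h]
      by_cases hi' : i ≤ ω.2.firstHit
      · rw [if_pos hi', ω.rev_snd_nth hr h hi, if_pos hi']
      · rw [if_neg hi', ω.rev_snd_nth hr h (by omega), if_neg (by omega)]
        congr 1; omega

/-! #### Class `B2b` over class `B2a`: the second arc in `r` -/

/-- The hits of a walk of class `B2a`. [folklore] -/
theorem hit_cases_of_isB2a (h : ω.IsB2a) {i : ℕ} (hi : i ∈ ω.2.hitIdx r) :
    i = ω.2.firstHit ∨ i = ω.2.firstHit + 1 ∨ i = ω.2.arcs.length := by
  have h1 := ω.2.firstHit_le_of_mem hi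
  have h2 := ((YBWalk.mem_hitIdx _ r).1 hi).1
  by_contra hne
  push Not at hne
  have hlt : ω.2.firstHit + 1 < i := by omega
  exact ω.2.not_mem_hitIdx_of_between h.1 hlt (by rw [h.2]; omega) hi

/-- A `S–N` pair of sides is straight. [folklore] -/
theorem _root_.Literature.Probability.RandomPlanarGeometry.SAW.YangBaxter.arcKind_of_isSN {f : Face} {s t : Side}
    (h : IsSN f (f.side s, f.side t)) : arcKind s t = .straight := by
  rcases h with e | e <;>
  · obtain ⟨e1, e2⟩ := Prod.mk.inj e
    rw [f.side_injective e1, f.side_injective e2]; rfl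

/-- A `W–E` pair of sides is straight. [folklore] -/
theorem _root_.Literature.Probability.RandomPlanarGeometry.SAW.YangBaxter.arcKind_of_isWE {f : Face} {s t : Side}
    (h : IsWE f (f.side s, f.side t)) : arcKind s t = .straight := by
  rcases h with e | e <;>
  · obtain ⟨e1, e2⟩ := Prod.mk.inj e
    rw [f.side_injective e1, f.side_injective e2]; rfl

/-- The side of a square not among three given distinct ones. [folklore] -/
def _root_.Literature.Probability.RandomPlanarGeometry.SAW.YangBaxter.Side.fourth (a b c : Side) : Side :=
  if Side.W ≠ a ∧ Side.W ≠ b ∧ Side.W ≠ c then .W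
  else if Side.E ≠ a ∧ Side.E ≠ b ∧ Side.E ≠ c then .E
  else if Side.S ≠ a ∧ Side.S ≠ b ∧ Side.S ≠ c then .S else .N

/-- `Side.fourth` is the remaining side. [folklore] -/
theorem _root_.Literature.Probability.RandomPlanarGeometry.SAW.YangBaxter.Side.fourth_spec {a b c : Side}
    (hab : a ≠ b) (hac : a ≠ c) (hbc : b ≠ c) :
    Side.fourth a b c ≠ a ∧ Side.fourth a b c ≠ b ∧ Side.fourth a b c ≠ c ∧
      ∀ d, d ≠ a → d ≠ b → d ≠ c → d = Side.fourth a b c := by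
  revert a b c; decide

/-- The first arc of the walk in `r` is not straight. [folklore] -/
def IsNS (hr : r ∈ rect T L) : Prop :=
  ∃ h : ω.IsB2a, arcKind ω.2.firstSide (ω.2.exitSide hr (by have := h.1; unfold IsB2 at this; omega)) ≠ .straight

/-- The fourth side for a walk of class `B2a`. [folklore] -/
def z₃ (hr : r ∈ rect T L) (h : ω.IsB2a) : Side :=
  Side.fourth ω.2.firstSide (ω.2.exitSide hr (by have := h.1; unfold IsB2 at this; omega)) ω.1

/-- The fourth side differs from the first three. [folklore] -/
theorem z₃_spec (hr : r ∈ rect T L) (h : ω.IsB2a) :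
    ω.z₃ hr h ≠ ω.2.firstSide ∧ ω.z₃ hr h ≠ ω.2.exitSide hr (by have := h.1; unfold IsB2 at this; omega) ∧
      ω.z₃ hr h ≠ ω.1 := by
  have hd := ω.2.sides_distinct hr h.1
  rw [ω.returnSide_of_isB2a h] at hd
  obtain ⟨h1, h2, h3, -⟩ := Side.fourth_spec hd.1.symm hd.2.1.symm hd.2.2.symm
  exact ⟨h1, h2, h3⟩

/-- **Extension of a walk of class `B2a` by the second arc of `r`** (when the first one is not
straight; junk otherwise). [folklore] -/
def ext₃ (hr : r ∈ rect T L) : Ω T L r :=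
  if h : ω.IsNS hr then
    ⟨ω.z₃ hr h.1, ω.2.snoc (r.side (ω.z₃ hr h.1)) r (arcFace_side_side r _ _ (ω.z₃_spec hr h.1).2.2.symm) hr
      (by
        rw [ω.2.mem_mids_iff_nth]
        rintro ⟨i, hi, e⟩
        have hsp := ω.z₃_spec hr h.1
        rcases ω.hit_cases_of_isB2a h.1 ((YBWalk.mem_hitIdx _ r).2 ⟨hi, _, e⟩) with rfl | rfl | rfl
        · rw [ω.2.nth_firstHit] at e; exact hsp.1 (r.side_injective e).symm
        · rw [(ω.2.exitSide_spec hr (by omega)).1] at e; exact hsp.2.1 (r.side_injective e).symm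
        · rw [ω.2.nth_length] at e; exact hsp.2.2 (r.side_injective e).symm)
      (by
        intro i hi
        have := ω.arcFace_ne_of_isB2a hr h.1 (i := i) (by omega) (by have := h.1.1; unfold IsB2 at this; omega)
        rwa [hi, ω.2.nth_length] at this)
      (by
        intro _ i hi hSN
        have hin := arcFace_of_isSN hSN
        have : i = ω.2.firstHit := by
          by_contra hne; exact ω.arcFace_ne_of_isB2a hr h.1 hi hne hin
        subst this
        rw [ω.2.nth_firstHit, (ω.2.exitSide_spec hr hi).1] at hSN
        exact h.2 (arcKind_of_isSN hSN))
      (by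
        intro _ i hi hWE
        have hin := arcFace_of_isWE hWE
        have : i = ω.2.firstHit := by
          by_contra hne; exact ω.arcFace_ne_of_isB2a hr h.1 hi hne hin
        subst this
        rw [ω.2.nth_firstHit, (ω.2.exitSide_spec hr hi).1] at hWE
        exact h.2 (arcKind_of_isWE hWE))⟩
  else ω

/-- The label of the two-arc extension. [folklore] -/
theorem ext₃_fst (hr : r ∈ rect T L) (h : ω.IsNS hr) : (ω.ext₃ hr).1 = ω.z₃ hr h.1 := by
  rw [ext₃, dif_pos h]

/-- The arcs of the two-arc extension. [folklore] -/
theorem ext₃_snd_arcs (hr : r ∈ rect T L) (h : ω.IsNS hr) :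
    (ω.ext₃ hr).2.arcs = ω.2.arcs ++ [(r.side ω.1, r.side (ω.z₃ hr h.1))] := by
  rw [ext₃, dif_pos h]; dsimp only; apply YBWalk.snoc_arcs

/-- The two-arc extension has one more arc. [folklore] -/
theorem ext₃_snd_length (hr : r ∈ rect T L) (h : ω.IsNS hr) :
    (ω.ext₃ hr).2.arcs.length = ω.2.arcs.length + 1 := by
  rw [ω.ext₃_snd_arcs hr h, List.length_append, List.length_singleton]

/-- The two-arc extension agrees with the walk. [folklore] -/
theorem ext₃_snd_nth (hr : r ∈ rect T L) (h : ω.IsNS hr) {i : ℕ} (hi : i ≤ ω.2.arcs.length) :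
    (ω.ext₃ hr).2.nth i = ω.2.nth i := by
  rw [ext₃, dif_pos h]; dsimp only; apply YBWalk.snoc_nth; exact hi

/-- The two-arc extension is of class `B2b`. [folklore] -/
theorem ext₃_isB2b (hr : r ∈ rect T L) (h : ω.IsNS hr) : (ω.ext₃ hr).IsB2b := by
  have hB2 : ω.2.firstHit + 1 < ω.2.arcs.length := h.1.1
  have hagree := fun i hi => ω.ext₃_snd_nth hr h (i := i) hi
  have hl := ω.ext₃_snd_length hr h
  have e1 := YBWalk.firstHit_eq_of_agree ω.2 (ω.ext₃ hr).2 le_rfl (by rw [hl]; omega) hagree ω.2.firstHit_le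
  have hB2' : (ω.ext₃ hr).IsB2 := by unfold IsB2; rw [e1, hl]; omega
  refine ⟨hB2', ?_⟩
  rw [YBWalk.returnHit_eq_of_agree ω.2 (ω.ext₃ hr).2 le_rfl (by rw [hl]; omega) hagree hB2 hB2' (ω.2.returnHit_le _),
    h.1.2, hl]
  omega

/-- A walk of class `B2b` ends at its fourth side. [folklore] -/
theorem fourthSide_of_isB2b (hr : r ∈ rect T L) (h : ω.IsB2b) : ω.2.fourthSide hr h.1 h.2 = ω.1 := by
  apply r.side_injective
  rw [← (ω.2.fourthSide_spec hr h.1 h.2).1, ω.2.returnHit_add_one_eq hr h.1 h.2, ω.2.nth_length]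

/-- In class `B2b` the two arcs in `r` are not straight. [folklore] -/
theorem not_straight_of_isB2b (hr : r ∈ rect T L) (h : ω.IsB2b) :
    arcKind ω.2.firstSide (ω.2.exitSide hr (by have := h.1; unfold IsB2 at this; omega)) ≠ .straight := by
  intro hs
  have hfh : ω.2.firstHit < ω.2.arcs.length := by have := h.1; unfold IsB2 at this; omega
  have hd := ω.2.sides_distinct hr h.1
  have h4 := (ω.2.fourthSide_spec hr h.1 h.2).2
  -- the fourth side differs from the first three
  have hR := ω.2.returnHit_le h.1
  have hR' := (ω.2.returnHit_mem h.1).2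
  have e4 := (ω.2.fourthSide_spec hr h.1 h.2).1
  have hlt := h.2
  have h40 : ω.2.fourthSide hr h.1 h.2 ≠ ω.2.firstSide := fun hh => by
    have := ω.2.nth_inj (i := ω.2.returnHit h.1 + 1) (j := ω.2.firstHit) (by omega) (by omega)
      (by rw [e4, ω.2.nth_firstHit, hh])
    omega
  have h41 : ω.2.fourthSide hr h.1 h.2 ≠ ω.2.exitSide hr hfh := fun hh => by
    have := ω.2.nth_inj (i := ω.2.returnHit h.1 + 1) (j := ω.2.firstHit + 1) (by omega) (by omega)
      (by rw [e4, (ω.2.exitSide_spec hr hfh).1, hh])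
    omega
  rcases straight_compl hd.1.symm hd.2.1.symm h40.symm hd.2.2.symm h41.symm h4.symm hs r with ⟨hWE, hSN⟩ | ⟨hSN, hWE⟩
  · refine ω.2.nc_nth hfh h.2 r ?_ ?_
    · rwa [ω.2.nth_firstHit, (ω.2.exitSide_spec hr hfh).1]
    · rwa [ω.2.nth_returnHit, e4]
  · refine ω.2.nc_nth h.2 hfh r ?_ ?_
    · rwa [ω.2.nth_returnHit, e4]
    · rwa [ω.2.nth_firstHit, (ω.2.exitSide_spec hr hfh).1]

/-- **The walk of class `B2a` under a walk of class `B2b`**: drop the last arc. [folklore] -/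
def base₂ (hr : r ∈ rect T L) : Ω T L r :=
  if h : ω.IsB2b then
    ⟨ω.2.returnSide h.1, (ω.2.dropLast (by have := h.2; omega)).cast rfl (by
      rw [← ω.2.nth_returnHit h.1]; congr 1
      have := ω.2.returnHit_add_one_eq hr h.1 h.2; omega)⟩
  else ω

/-- The label of the base walk of class `B2a`. [folklore] -/
theorem base₂_fst (hr : r ∈ rect T L) (h : ω.IsB2b) : (ω.base₂ hr).1 = ω.2.returnSide h.1 := by
  rw [base₂, dif_pos h]

/-- The base walk has one arc less. [folklore] -/
theorem base₂_snd_length (hr : r ∈ rect T L) (h : ω.IsB2b) : (ω.base₂ hr).2.arcs.length = ω.2.arcs.length - 1 := by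
  rw [base₂, dif_pos h]; dsimp only
  rw [YBWalk.length_arcs, YBWalk.cast_mids, ← YBWalk.length_arcs]; apply YBWalk.dropLast_length

/-- The base walk agrees with the walk. [folklore] -/
theorem base₂_snd_nth (hr : r ∈ rect T L) (h : ω.IsB2b) {i : ℕ} (hi : i ≤ ω.2.arcs.length - 1) :
    (ω.base₂ hr).2.nth i = ω.2.nth i := by
  rw [base₂, dif_pos h]; dsimp only
  rw [YBWalk.nth, YBWalk.cast_mids, ← YBWalk.nth]; apply YBWalk.dropLast_nth; exact hi

/-- The base walk ends at the return. [folklore] -/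
theorem base₂_length_eq (hr : r ∈ rect T L) (h : ω.IsB2b) : (ω.base₂ hr).2.arcs.length = ω.2.returnHit h.1 := by
  rw [ω.base₂_snd_length hr h]; have := ω.2.returnHit_add_one_eq hr h.1 h.2; omega

/-- The base walk has the same first hit. [folklore] -/
theorem base₂_firstHit (hr : r ∈ rect T L) (h : ω.IsB2b) : (ω.base₂ hr).2.firstHit = ω.2.firstHit :=
  YBWalk.firstHit_eq_of_agree ω.2 (ω.base₂ hr).2 (m := ω.2.arcs.length - 1) (by omega)
    (by rw [ω.base₂_snd_length hr h]) (fun i hi => ω.base₂_snd_nth hr h hi)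
    (by have := h.1; unfold IsB2 at this; omega)

/-- The base walk is of class `B2`. [folklore] -/
theorem base₂_isB2 (hr : r ∈ rect T L) (h : ω.IsB2b) : (ω.base₂ hr).IsB2 := by
  unfold IsB2
  rw [ω.base₂_firstHit hr h, ω.base₂_length_eq hr h]
  have := ω.2.firstHit_add_three_le_returnHit hr h.1; omega

/-- The base walk has the same return index. [folklore] -/
theorem base₂_returnHit (hr : r ∈ rect T L) (h : ω.IsB2b) :
    (ω.base₂ hr).2.returnHit (ω.base₂_isB2 hr h) = ω.2.returnHit h.1 :=
  YBWalk.returnHit_eq_of_agree ω.2 (ω.base₂ hr).2 (m := ω.2.arcs.length - 1) (by omega)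
    (by rw [ω.base₂_snd_length hr h]) (fun i hi => ω.base₂_snd_nth hr h hi) h.1 _
    (by have := ω.2.returnHit_add_one_eq hr h.1 h.2; omega)

/-- The base walk is of class `B2a`. [folklore] -/
theorem base₂_isB2a (hr : r ∈ rect T L) (h : ω.IsB2b) : (ω.base₂ hr).IsB2a :=
  ⟨ω.base₂_isB2 hr h, by rw [ω.base₂_returnHit hr h, ω.base₂_length_eq hr h]⟩

/-- The base walk has the same first side. [folklore] -/
theorem base₂_firstSide (hr : r ∈ rect T L) (h : ω.IsB2b) : (ω.base₂ hr).2.firstSide = ω.2.firstSide :=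
  YBWalk.firstSide_eq_of_agree ω.2 (ω.base₂ hr).2 (m := ω.2.arcs.length - 1) (by omega)
    (by rw [ω.base₂_snd_length hr h]) (fun i hi => ω.base₂_snd_nth hr h hi)
    (by have := h.1; unfold IsB2 at this; omega)

/-- The base walk has the same exit side. [folklore] -/
theorem base₂_exitSide (hr : r ∈ rect T L) (h : ω.IsB2b) :
    (ω.base₂ hr).2.exitSide hr (by have := ω.base₂_isB2 hr h; unfold IsB2 at this; omega) =
      ω.2.exitSide hr (by have := h.1; unfold IsB2 at this; omega) :=
  YBWalk.exitSide_eq_of_agree ω.2 (ω.base₂ hr).2 hr (m := ω.2.arcs.length - 1) (by omega)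
    (by rw [ω.base₂_snd_length hr h]) (fun i hi => ω.base₂_snd_nth hr h hi)
    (by have := h.1; unfold IsB2 at this; omega) _ _

/-- The first arc of the base walk is not straight. [folklore] -/
theorem base₂_isNS (hr : r ∈ rect T L) (h : ω.IsB2b) : (ω.base₂ hr).IsNS hr := by
  refine ⟨ω.base₂_isB2a hr h, ?_⟩
  rw [ω.base₂_firstSide hr h, ω.base₂_exitSide hr h]
  exact ω.not_straight_of_isB2b hr h

/-- The fourth side of the base walk is the end of the walk. [folklore] -/
theorem base₂_z₃ (hr : r ∈ rect T L) (h : ω.IsB2b) : (ω.base₂ hr).z₃ hr (ω.base₂_isB2a hr h) = ω.1 := by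
  unfold z₃
  rw [ω.base₂_firstSide hr h, ω.base₂_exitSide hr h, ω.base₂_fst hr h]
  have hfh : ω.2.firstHit < ω.2.arcs.length := by have := h.1; unfold IsB2 at this; omega
  have hd := ω.2.sides_distinct hr h.1
  have h4 := (ω.2.fourthSide_spec hr h.1 h.2).2
  have hR := ω.2.returnHit_le h.1
  have hR' := (ω.2.returnHit_mem h.1).2
  have e4 := (ω.2.fourthSide_spec hr h.1 h.2).1
  have hlt := h.2
  have h40 : ω.2.fourthSide hr h.1 h.2 ≠ ω.2.firstSide := fun hh => by
    have := ω.2.nth_inj (i := ω.2.returnHit h.1 + 1) (j := ω.2.firstHit) (by omega) (by omega)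
      (by rw [e4, ω.2.nth_firstHit, hh])
    omega
  have h41 : ω.2.fourthSide hr h.1 h.2 ≠ ω.2.exitSide hr hfh := fun hh => by
    have := ω.2.nth_inj (i := ω.2.returnHit h.1 + 1) (j := ω.2.firstHit + 1) (by omega) (by omega)
      (by rw [e4, (ω.2.exitSide_spec hr hfh).1, hh])
    omega
  have key := (Side.fourth_spec hd.1.symm hd.2.1.symm hd.2.2.symm).2.2.2 _ h40 h41 h4
  -- `fourthSide = ω.1`
  have e := ω.fourthSide_of_isB2b hr h
  rw [e] at key
  exact key.symm

/-- Extending the base walk gives back the walk. [folklore] -/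
theorem ext₃_base₂ (hr : r ∈ rect T L) (h : ω.IsB2b) : (ω.base₂ hr).ext₃ hr = ω := by
  have hN := ω.base₂_isNS hr h
  have hlen : ((ω.base₂ hr).ext₃ hr).2.arcs.length = ω.2.arcs.length := by
    rw [(ω.base₂ hr).ext₃_snd_length hr hN, ω.base₂_snd_length hr h]; have := h.2; omega
  apply ext_of_mids
  · rw [(ω.base₂ hr).ext₃_fst hr hN, ω.base₂_z₃ hr h]
  · apply YBWalk.mids_ext_nth _ _ hlen
    intro i hi
    rcases hi.lt_or_eq with hi | rfl
    · rw [(ω.base₂ hr).ext₃_snd_nth hr hN (by rw [ω.base₂_snd_length hr h]; omega), ω.base₂_snd_nth hr h (by omega)]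
    · have e1 := ((ω.base₂ hr).ext₃ hr).2.nth_length
      rw [hlen] at e1
      exact (e1.trans (congrArg r.side (((ω.base₂ hr).ext₃_fst hr hN).trans (ω.base₂_z₃ hr h)))).trans
        ω.2.nth_length.symm

/-- The base of the extension is the walk. [folklore] -/
theorem base₂_ext₃ (hr : r ∈ rect T L) (h : ω.IsNS hr) : (ω.ext₃ hr).base₂ hr = ω := by
  have hB := ω.ext₃_isB2b hr h
  have hagree := fun i hi => ω.ext₃_snd_nth hr h (i := i) hi
  have hl := ω.ext₃_snd_length hr h
  apply ext_of_mids
  · rw [(ω.ext₃ hr).base₂_fst hr hB,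
      YBWalk.returnSide_eq_of_agree ω.2 (ω.ext₃ hr).2 le_rfl (by rw [hl]; omega) hagree h.1.1 hB.1
        (ω.2.returnHit_le _), ω.returnSide_of_isB2a h.1]
  · apply YBWalk.mids_ext_nth
    · rw [(ω.ext₃ hr).base₂_snd_length hr hB, hl]; rfl
    · intro i hi
      rw [(ω.ext₃ hr).base₂_snd_nth hr hB (by rw [hl]; omega), hagree i hi]

end Ω

/-! #### The weights of the grouped walks -/

/-- The phase is multiplicative. [folklore] -/
theorem phase_add (x y : ℝ) : phase (x + y) = phase x * phase y := by
  rw [phase, phase, phase, ← Complex.exp_add]; congr 1; push_cast; ring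

/-- The phase of a difference. [folklore] -/
theorem phase_sub (x y : ℝ) : phase (x - y) = phase x * phase (-y) := by
  rw [sub_eq_add_neg, phase_add]

/-- The rotation of an arc between two sides of `f`. [folklore] -/
theorem arcTurnOf_side_side (Θ : ℤ → ℝ) (f : Face) {s t : Side} (hst : s ≠ t) :
    arcTurnOf Θ (f.side s, f.side t) = arcTurn (Θ f.1) s t := by
  unfold arcTurnOf
  rw [arcFace_side_side f s t hst]
  simp

/-- The complex weight as exterior weight, local weight of `r` and phase. [folklore] -/
theorem _root_.Literature.Probability.RandomPlanarGeometry.SAW.YangBaxter.YBWalk.paraWeight_eq {D : Set Face} {a z : MidEdge}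
    (γ : YBWalk D a z) (Θ : ℤ → ℝ) (r : Face) :
    γ.paraWeight Θ = (γ.extWeight Θ r : ℂ) * (localWeight (Θ r.1) (γ.kindsIn r) : ℂ) * phase (γ.winding Θ) := by
  rw [YBWalk.paraWeight, γ.weight_eq_extWeight_mul Θ r, phase]; push_cast; ring

namespace Ω

variable (ω : Ω T L r) (Θ : ℤ → ℝ)

/-- The summand of the vertex relation: `c(z) · (complex weight)`. [folklore] -/
def g : ℂ := crCoef (Θ r.1) ω.1 * ω.2.paraWeight Θ

/-- In class `A`, `r` carries no arc. [folklore] -/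
theorem kindsIn_of_isA (h : ω.IsA) : ω.2.kindsIn r = [] := by
  rw [YBWalk.kindsIn_eq, List.filterMap_eq_nil_iff]
  intro p hp
  obtain ⟨i, hi, rfl⟩ := (ω.2.mem_arcs_iff_nth).1 hp
  exact kindF_of_ne (ω.arcFace_ne_of_isA h hi)

/-- **Weight of the one-arc extension**: `w · u(z₀z₁) · e^{-iσ(W + t(z₀z₁))}`. [folklore] -/
theorem paraWeight_extA (hr : r ∈ rect T L) {z₁ : Side} (h : ω.IsA) (hz : z₁ ≠ ω.1) :
    (ω.extA hr z₁).2.paraWeight Θ =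
      ω.2.paraWeight Θ * (arcWeight (Θ r.1) ω.1 z₁ : ℂ) * phase (arcTurn (Θ r.1) ω.1 z₁) := by
  have harcs := ω.extA_snd_arcs hr h hz
  have hface : arcFace (r.side ω.1, r.side z₁) = some r := arcFace_side_side r _ _ hz.symm
  rw [(ω.extA hr z₁).2.paraWeight_eq Θ r, ω.2.paraWeight_eq Θ r,
    YBWalk.extWeight_of_snoc ω.2 (ω.extA hr z₁).2 r harcs hface,
    YBWalk.kindsIn_of_snoc ω.2 (ω.extA hr z₁).2 r harcs hface,
    YBWalk.winding_of_snoc ω.2 (ω.extA hr z₁).2 harcs, ω.kindsIn_of_isA h,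
    arcKindOf_eq hface rfl rfl, arcTurnOf_side_side Θ r hz.symm, phase_add]
  simp [List.reduceOption, localWeight, arcWeight]
  ring

/-! #### Weights in class `B2a` -/

section B2a

variable (hr : r ∈ rect T L)

/-- The winding of the prefix before the first crossing. [folklore] -/
def WP : ℝ := ((ω.2.arcs.take ω.2.firstHit).map (arcTurnOf Θ)).sum

/-- The winding of the excursion (everything after the first arc in `r`). [folklore] -/
def WE : ℝ := ((ω.2.arcs.drop (ω.2.firstHit + 1)).map (arcTurnOf Θ)).sum

/-- In class `B2a` the walk continues after its first hit. [folklore] -/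
theorem fh_lt (h : ω.IsB2a) : ω.2.firstHit < ω.2.arcs.length := by have := h.1; unfold IsB2 at this; omega

/-- The first arc in `r`, as a pair of sides. [folklore] -/
theorem arcs_fh (h : ω.IsB2a) :
    ω.2.arcs[ω.2.firstHit]'(ω.fh_lt h) = (r.side ω.2.firstSide, r.side (ω.2.exitSide hr (ω.fh_lt h))) := by
  rw [ω.2.arcs_getElem_eq_nth, ω.2.nth_firstHit, (ω.2.exitSide_spec hr _).1]

/-- **Weight in class `B2a`.** [folklore] -/
theorem paraWeight_of_isB2a (h : ω.IsB2a) :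
    ω.2.paraWeight Θ = (ω.2.extWeight Θ r : ℂ) * (arcWeight (Θ r.1) ω.2.firstSide (ω.2.exitSide hr (ω.fh_lt h)) : ℂ) *
      phase (ω.WP Θ + arcTurn (Θ r.1) ω.2.firstSide (ω.2.exitSide hr (ω.fh_lt h)) + ω.WE Θ) := by
  rw [ω.2.paraWeight_eq Θ r, ω.kindsIn_of_isB2a hr h, ω.2.winding_orig_split ω.2.firstHit (ω.fh_lt h) Θ, ω.arcs_fh hr h,
    arcTurnOf_side_side Θ r (ω.2.exitSide_spec hr _).2.symm]
  rfl

/-- Reversal keeps the exterior weight. [folklore] -/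
theorem rev_extWeight (h : ω.IsB2a) : (ω.rev hr).2.extWeight Θ r = ω.2.extWeight Θ r :=
  YBWalk.extWeight_of_revSuffix ω.2 (ω.rev hr).2 r ω.2.firstHit _ (ω.rev_snd_arcs hr h)
    (by
      rw [ω.2.nth_firstHit]
      refine arcFace_side_side r _ _ fun e => ?_
      have := (ω.2.sides_distinct hr h.1).2.1
      rw [ω.returnSide_of_isB2a h] at this
      exact this e.symm)
    (ω.fh_lt h) (by rw [ω.arcs_fh hr h]; exact arcFace_side_side r _ _ (ω.2.exitSide_spec hr _).2.symm) Θ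

/-- Reversal keeps the winding of the prefix. [folklore] -/
theorem rev_WP (h : ω.IsB2a) : (ω.rev hr).WP Θ = ω.WP Θ := by
  unfold WP
  rw [ω.rev_firstHit hr h, ω.rev_snd_arcs hr h, List.append_assoc,
    List.take_append_of_le_length (by simpa using (ω.fh_lt h).le), List.take_take, min_self]

/-- **Reversal negates the winding of the excursion.** [folklore] -/
theorem rev_WE (h : ω.IsB2a) : (ω.rev hr).WE Θ = -ω.WE Θ := by
  unfold WE
  rw [ω.rev_firstHit hr h, ω.rev_snd_arcs hr h,
    List.drop_append_of_le_length (by simp; exact (ω.fh_lt h).le)]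
  have hl : (ω.2.arcs.take ω.2.firstHit ++ [(ω.2.nth ω.2.firstHit, r.side ω.1)]).length = ω.2.firstHit + 1 := by
    simp; exact (ω.fh_lt h).le
  rw [List.drop_eq_nil_of_le (by rw [hl]), List.nil_append, YBWalk.sum_map_arcTurnOf_swap]

/-- The first side of a walk of class `B2a` is not its end. [folklore] -/
theorem firstSide_ne_fst (h : ω.IsB2a) : ω.2.firstSide ≠ ω.1 := by
  intro e
  have := ω.2.nth_inj (i := ω.2.firstHit) (j := ω.2.arcs.length) ω.2.firstHit_le le_rfl
    (by rw [ω.2.nth_firstHit, e, ω.2.nth_length])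
  have := ω.fh_lt h; omega

/-- **Weight of the reversed walk.** [folklore] -/
theorem paraWeight_rev (h : ω.IsB2a) :
    (ω.rev hr).2.paraWeight Θ = (ω.2.extWeight Θ r : ℂ) * (arcWeight (Θ r.1) ω.2.firstSide ω.1 : ℂ) *
      phase (ω.WP Θ + arcTurn (Θ r.1) ω.2.firstSide ω.1 - ω.WE Θ) := by
  have h' := ω.rev_isB2a hr h
  rw [(ω.rev hr).paraWeight_of_isB2a Θ hr h', ω.rev_extWeight Θ hr h, ω.rev_WP Θ hr h, ω.rev_WE Θ hr h,
    ω.rev_firstSide hr h, ω.rev_exitSide hr h]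
  ring_nf

/-- `Side.fourth` is symmetric in its last two arguments. [folklore] -/
theorem _root_.Literature.Probability.RandomPlanarGeometry.SAW.YangBaxter.Side.fourth_swap (a b c : Side) :
    Side.fourth a c b = Side.fourth a b c := by
  revert a b c; decide

/-- Reversal keeps the fourth side. [folklore] -/
theorem rev_z₃ (h : ω.IsB2a) : (ω.rev hr).z₃ hr (ω.rev_isB2a hr h) = ω.z₃ hr h := by
  unfold z₃
  rw [ω.rev_firstSide hr h, ω.rev_exitSide hr h, ω.rev_fst hr h, Side.fourth_swap]

/-- The first arc of the reversed walk is `z₀ → z₂`. [folklore] -/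
theorem rev_isNS_iff (h : ω.IsB2a) : (ω.rev hr).IsNS hr ↔ arcKind ω.2.firstSide ω.1 ≠ .straight := by
  constructor
  · rintro ⟨h', hns⟩
    rwa [ω.rev_firstSide hr h, ω.rev_exitSide hr h] at hns
  · intro hns
    refine ⟨ω.rev_isB2a hr h, ?_⟩
    rwa [ω.rev_firstSide hr h, ω.rev_exitSide hr h]

/-- **Weight of the two-arc extension.** [folklore] -/
theorem paraWeight_ext₃ (h : ω.IsNS hr) :
    (ω.ext₃ hr).2.paraWeight Θ = (ω.2.extWeight Θ r : ℂ) *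
      (pairWeight (Θ r.1) ω.2.firstSide (ω.2.exitSide hr (ω.fh_lt h.1)) ω.1 (ω.z₃ hr h.1) : ℂ) *
      phase (ω.WP Θ + arcTurn (Θ r.1) ω.2.firstSide (ω.2.exitSide hr (ω.fh_lt h.1)) + ω.WE Θ +
        arcTurn (Θ r.1) ω.1 (ω.z₃ hr h.1)) := by
  have harcs := ω.ext₃_snd_arcs hr h
  have hz := (ω.z₃_spec hr h.1).2.2
  have hface : arcFace (r.side ω.1, r.side (ω.z₃ hr h.1)) = some r := arcFace_side_side r _ _ hz.symm
  rw [(ω.ext₃ hr).2.paraWeight_eq Θ r,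
    YBWalk.extWeight_of_snoc ω.2 (ω.ext₃ hr).2 r harcs hface,
    YBWalk.kindsIn_of_snoc ω.2 (ω.ext₃ hr).2 r harcs hface,
    YBWalk.winding_of_snoc ω.2 (ω.ext₃ hr).2 harcs, ω.kindsIn_of_isB2a hr h.1,
    ω.2.winding_orig_split ω.2.firstHit (ω.fh_lt h.1) Θ, ω.arcs_fh hr h.1,
    arcTurnOf_side_side Θ r (ω.2.exitSide_spec hr _).2.symm,
    arcKindOf_eq hface rfl rfl, arcTurnOf_side_side Θ r hz.symm]
  simp only [List.reduceOption, List.filterMap_cons, List.filterMap_nil, id, List.singleton_append, pairWeight, WP, WE]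

/-- The term of the second member of the group (zero when that member does not exist). [folklore] -/
def T₃ : ℂ := if ω.IsNS hr then (ω.ext₃ hr).g Θ else 0

/-- **The second member's term in closed form** (the weight vanishes exactly when the member does
not exist). [folklore] -/
theorem T₃_eq (h : ω.IsB2a) :
    ω.T₃ Θ hr = crCoef (Θ r.1) (ω.z₃ hr h) * ((ω.2.extWeight Θ r : ℂ) *
      (pairWeight (Θ r.1) ω.2.firstSide (ω.2.exitSide hr (ω.fh_lt h)) ω.1 (ω.z₃ hr h) : ℂ) *
      phase (ω.WP Θ + arcTurn (Θ r.1) ω.2.firstSide (ω.2.exitSide hr (ω.fh_lt h)) + ω.WE Θ +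
        arcTurn (Θ r.1) ω.1 (ω.z₃ hr h))) := by
  unfold T₃
  by_cases hns : ω.IsNS hr
  · rw [if_pos hns, g, ω.paraWeight_ext₃ Θ hr hns, ω.ext₃_fst hr hns]
  · rw [if_neg hns]
    have hs : arcKind ω.2.firstSide (ω.2.exitSide hr (ω.fh_lt h)) = .straight := by
      by_contra hne; exact hns ⟨h, hne⟩
    rw [pairWeight, hs, localWeight_straight_cons]
    simp

/-- The grouped term of a walk of class `B2a`: itself and its two-arc extension. [folklore] -/
def G : ℂ := ω.g Θ + ω.T₃ Θ hr

end B2a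

end Ω

/-- **The excursion windings** (the topological input of the grouping argument; Hopf's
Umlaufsatz for the simple closed curve formed by an excursion of a self-avoiding walk outside a
rhombus `r` and the chord of `r` between its ends). For a walk `γ` of `Rect_{T,L}(Θ)` from `0`
ending on `∂r` exactly at its first return to `∂r` (class `B2a`: first crossing of `∂r` at the
side `z₀`, one arc of `r` to the side `z₁`, then an excursion in `Rect ∖ r` back to the side
`z₂` where it stops), the winding of the excursion is the tabulated value
`excursionWinding θ_r z₀ z₁ z₂` (e.g. `−π − θ` for `(z₀, z₁, z₂) = (W, N, E)`: the excursion goes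
clockwise around the corner of angle `π − θ`). The printed proofs use these values silently
("the winding of these walks differs by …", [Gl] proof of Lemma 3.1; GM proof of Lemma 2.1).
[cite: GlazmanManolescu2019, Lemma 2.1 (proof); Glazman2015WeightedSAW, Lemma 3.1 (proof)] -/
def GlazmanManolescu2019_excursionWinding : Prop :=
  ∀ (T L : ℕ) (Θ : ℤ → ℝ), (∀ k, Θ k ∈ Set.Icc (π / 3) (2 * π / 3)) →
    ∀ (r : Face) (hr : r ∈ rect T L) (ω : Ω T L r) (h : ω.IsB2a),
      ω.WE Θ = excursionWinding (Θ r.1) ω.2.firstSide (ω.2.exitSide hr (ω.fh_lt h)) ω.1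

namespace Ω

variable (ω : Ω T L r) (Θ : ℤ → ℝ) (hr : r ∈ rect T L)

/-- **The group of an excursion sums to zero**: the four walks sharing the prefix and the
excursion (in either direction) cancel, by the second local relation. [cite: GlazmanManolescu2019, Lemma 2.1 (proof)] -/
theorem G_add_G_rev (hW : GlazmanManolescu2019_excursionWinding) (hΘ : ∀ k, Θ k ∈ Set.Icc (π / 3) (2 * π / 3))
    (h : ω.IsB2a) : ω.G Θ hr + (ω.rev hr).G Θ hr = 0 := by
  have h' := ω.rev_isB2a hr h
  have hX := hW T L Θ hΘ r hr ω h
  have hd := ω.2.sides_distinct hr h.1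
  rw [ω.returnSide_of_isB2a h] at hd
  have hz := ω.z₃_spec hr h
  have key := groupTwo_gen (Θ r.1) ω.2.firstSide (ω.2.exitSide hr (ω.fh_lt h)) ω.1 (ω.z₃ hr h)
    hd.1.symm hd.2.1.symm hz.1.symm hd.2.2.symm hz.2.1.symm hz.2.2.symm
  unfold bracket at key
  rw [G, G, g, g, ω.T₃_eq Θ hr h, (ω.rev hr).T₃_eq Θ hr h', ω.paraWeight_of_isB2a Θ hr h,
    ω.paraWeight_rev Θ hr h, ω.rev_extWeight Θ hr h, ω.rev_WP Θ hr h, ω.rev_WE Θ hr h, ω.rev_z₃ hr h,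
    ω.rev_firstSide hr h, ω.rev_exitSide hr h, ω.rev_fst hr h, hX]
  have e1 : ∀ a b : ℝ, phase (ω.WP Θ + a + b) = phase (ω.WP Θ) * phase (a + b) := fun a b => by
    rw [add_assoc, phase_add]
  have e2 : ∀ a b c : ℝ, phase (ω.WP Θ + a + b + c) = phase (ω.WP Θ) * phase (a + b + c) := fun a b c => by
    rw [add_assoc, add_assoc, phase_add, add_assoc]
  have e3 : ∀ a b : ℝ, phase (ω.WP Θ + a - b) = phase (ω.WP Θ) * phase (a - b) := fun a b => by
    rw [add_sub_assoc, phase_add]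
  have e4 : ∀ a b c : ℝ, phase (ω.WP Θ + a + -b + c) = phase (ω.WP Θ) * phase (a - b + c) := fun a b c => by
    rw [show ω.WP Θ + a + -b + c = ω.WP Θ + (a - b + c) by ring, phase_add]
  rw [e1, e2, e3, e4]
  linear_combination (ω.2.extWeight Θ r : ℂ) * phase (ω.WP Θ) * key

/-! #### The sums -/

variable (T L r)

/-- The walks of class `A`. [folklore] -/
def setA : Finset (Ω T L r) := Finset.univ.filter fun ω => ω.IsA
/-- The walks of class `B1`. [folklore] -/
def setB1 : Finset (Ω T L r) := Finset.univ.filter fun ω => ω.IsB1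
/-- The walks of class `B2a`. [folklore] -/
def setB2a : Finset (Ω T L r) := Finset.univ.filter fun ω => ω.IsB2a
/-- The walks of class `B2b`. [folklore] -/
def setB2b : Finset (Ω T L r) := Finset.univ.filter fun ω => ω.IsB2b

variable {T L r}

/-- Classes `A` and `B1` are disjoint. [folklore] -/
theorem not_isB1_of_isA (h : ω.IsA) : ¬ω.IsB1 := by unfold IsA IsB1 at *; omega
/-- Classes `A` and `B2` are disjoint. [folklore] -/
theorem not_isB2_of_isA (h : ω.IsA) : ¬ω.IsB2 := by unfold IsA IsB2 at *; omega
/-- Classes `B1` and `B2` are disjoint. [folklore] -/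
theorem not_isB2_of_isB1 (h : ω.IsB1) : ¬ω.IsB2 := by unfold IsB1 IsB2 at *; omega
/-- Classes `B2a` and `B2b` are disjoint. [folklore] -/
theorem not_isB2b_of_isB2a (h : ω.IsB2a) : ¬ω.IsB2b := fun h' => by have := h.2; have := h'.2; omega

/-- **The total splits over the four classes.** [folklore] -/
theorem sum_split (F : Ω T L r → ℂ) :
    ∑ ω, F ω = ∑ ω ∈ setA T L r, F ω + ∑ ω ∈ setB1 T L r, F ω + ∑ ω ∈ setB2a T L r, F ω + ∑ ω ∈ setB2b T L r, F ω := by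
  have hB1 : setB1 T L r = (Finset.univ.filter fun ω : Ω T L r => ¬ω.IsA).filter fun ω => ω.IsB1 := by
    ext ω; simp only [setB1, Finset.mem_filter, Finset.mem_univ, true_and]
    exact ⟨fun h => ⟨fun hA => ω.not_isB1_of_isA hA h, h⟩, fun h => h.2⟩
  have hB2a : setB2a T L r =
      ((Finset.univ.filter fun ω : Ω T L r => ¬ω.IsA).filter fun ω => ¬ω.IsB1).filter fun ω => ω.IsB2a := by
    ext ω; simp only [setB2a, Finset.mem_filter, Finset.mem_univ, true_and]
    exact ⟨fun h => ⟨⟨fun hA => ω.not_isB2_of_isA hA h.1, fun hB => ω.not_isB2_of_isB1 hB h.1⟩, h⟩, fun h => h.2⟩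
  have hB2b : setB2b T L r =
      ((Finset.univ.filter fun ω : Ω T L r => ¬ω.IsA).filter fun ω => ¬ω.IsB1).filter fun ω => ¬ω.IsB2a := by
    ext ω; simp only [setB2b, Finset.mem_filter, Finset.mem_univ, true_and]
    constructor
    · intro h
      exact ⟨⟨fun hA => ω.not_isB2_of_isA hA h.1, fun hB => ω.not_isB2_of_isB1 hB h.1⟩, fun h' => ω.not_isB2b_of_isB2a h' h⟩
    · rintro ⟨⟨hA, hB1⟩, hB2a⟩
      rcases ω.isA_or with h | h | h
      · exact absurd h hA
      · exact absurd h hB1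
      · rcases ω.isB2a_or h with h' | h'
        · exact absurd h' hB2a
        · exact h'
  rw [hB1, hB2a, hB2b, setA, add_assoc, add_assoc, Finset.sum_filter_add_sum_filter_not,
    Finset.sum_filter_add_sum_filter_not, Finset.sum_filter_add_sum_filter_not]

/-- **Class `B1` re-indexed over class `A`.** [folklore] -/
theorem sum_B1 (F : Ω T L r → ℂ) :
    ∑ ω ∈ setB1 T L r, F ω = ∑ ω ∈ setA T L r, ∑ z₁ ∈ Finset.univ.erase ω.1, F (ω.extA hr z₁) := by
  rw [← Finset.sum_sigma (setA T L r) (fun ω => Finset.univ.erase ω.1) (fun p => F (p.1.extA hr p.2))]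
  refine Finset.sum_nbij' (fun ω => ⟨ω.baseA, ω.1⟩) (fun p => p.1.extA hr p.2) ?_ ?_ ?_ ?_ ?_
  · intro ω hω
    simp only [setB1, Finset.mem_filter, Finset.mem_univ, true_and] at hω
    simp only [Finset.mem_sigma, setA, Finset.mem_filter, Finset.mem_univ, true_and, Finset.mem_erase, ne_eq]
    exact ⟨ω.baseA_isA hω, fun e => ω.firstSide_ne_of_isB1 hr hω ((ω.baseA_fst hω).symm.trans e.symm), trivial⟩
  · rintro ⟨P, z₁⟩ hp
    simp only [Finset.mem_sigma, setA, Finset.mem_filter, Finset.mem_univ, true_and, Finset.mem_erase] at hp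
    simp only [setB1, Finset.mem_filter, Finset.mem_univ, true_and]
    exact P.extA_isB1 hr hp.1 hp.2.1
  · intro ω hω
    simp only [setB1, Finset.mem_filter, Finset.mem_univ, true_and] at hω
    exact ω.extA_baseA hr hω
  · rintro ⟨P, z₁⟩ hp
    simp only [Finset.mem_sigma, setA, Finset.mem_filter, Finset.mem_univ, true_and, Finset.mem_erase] at hp
    simp only [Sigma.mk.injEq]
    refine ⟨P.baseA_extA hr hp.1 hp.2.1, ?_⟩
    rw [P.extA_fst hr hp.1 hp.2.1]
  · intro ω hω
    simp only [setB1, Finset.mem_filter, Finset.mem_univ, true_and] at hω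
    simp only
    rw [ω.extA_baseA hr hω]

/-- **The first group sums to zero.** [cite: GlazmanManolescu2019, Lemma 2.1 (proof)] -/
theorem sum_A_add_sum_B1 (hr : r ∈ rect T L) (hΘ : ∀ k, Θ k ∈ Set.Icc (π / 3) (2 * π / 3)) :
    ∑ ω ∈ setA T L r, ω.g Θ + ∑ ω ∈ setB1 T L r, ω.g Θ = 0 := by
  rw [sum_B1 hr, ← Finset.sum_add_distrib]
  refine Finset.sum_eq_zero fun ω hω => ?_
  simp only [setA, Finset.mem_filter, Finset.mem_univ, true_and] at hω
  have hθ : weightDen (Θ r.1) ≠ 0 := (weightDen_neg (hΘ r.1)).ne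
  have key := groupOne_gen (Θ r.1) hθ ω.1
  have e : ∀ z₁ ∈ Finset.univ.erase ω.1, (ω.extA hr z₁).g Θ =
      ω.2.paraWeight Θ * (crCoef (Θ r.1) z₁ * (arcWeight (Θ r.1) ω.1 z₁ : ℂ) * phase (arcTurn (Θ r.1) ω.1 z₁)) := by
    intro z₁ hz
    have hz' : z₁ ≠ ω.1 := Finset.ne_of_mem_erase hz
    rw [g, ω.paraWeight_extA Θ hr hω hz', ω.extA_fst hr hω hz']; ring
  rw [Finset.sum_congr rfl e, ← Finset.mul_sum, g]
  linear_combination ω.2.paraWeight Θ * key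

/-- **Class `B2b` re-indexed over class `B2a`.** [folklore] -/
theorem sum_B2b (F : Ω T L r → ℂ) :
    ∑ ω ∈ setB2b T L r, F ω = ∑ ω ∈ setB2a T L r, if ω.IsNS hr then F (ω.ext₃ hr) else 0 := by
  rw [← Finset.sum_filter]
  refine Finset.sum_nbij' (fun ω => ω.base₂ hr) (fun ω => ω.ext₃ hr) ?_ ?_ ?_ ?_ ?_
  · intro ω hω
    simp only [setB2b, Finset.mem_filter, Finset.mem_univ, true_and] at hω
    simp only [Finset.mem_filter, setB2a, Finset.mem_univ, true_and]
    exact ⟨ω.base₂_isB2a hr hω, ω.base₂_isNS hr hω⟩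
  · intro ω hω
    simp only [Finset.mem_filter, setB2a, Finset.mem_univ, true_and] at hω
    simp only [setB2b, Finset.mem_filter, Finset.mem_univ, true_and]
    exact ω.ext₃_isB2b hr hω.2
  · intro ω hω
    simp only [setB2b, Finset.mem_filter, Finset.mem_univ, true_and] at hω
    exact ω.ext₃_base₂ hr hω
  · intro ω hω
    simp only [Finset.mem_filter, setB2a, Finset.mem_univ, true_and] at hω
    exact ω.base₂_ext₃ hr hω.2
  · intro ω hω
    simp only [setB2b, Finset.mem_filter, Finset.mem_univ, true_and] at hω
    rw [ω.ext₃_base₂ hr hω]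

/-- **The second group sums to zero.** [cite: GlazmanManolescu2019, Lemma 2.1 (proof)] -/
theorem sum_B2a_add_sum_B2b (hr : r ∈ rect T L) (hW : GlazmanManolescu2019_excursionWinding) (hΘ : ∀ k, Θ k ∈ Set.Icc (π / 3) (2 * π / 3)) :
    ∑ ω ∈ setB2a T L r, ω.g Θ + ∑ ω ∈ setB2b T L r, ω.g Θ = 0 := by
  rw [sum_B2b hr, ← Finset.sum_add_distrib]
  change ∑ ω ∈ setB2a T L r, ω.G Θ hr = 0
  refine Finset.sum_involution (fun ω _ => ω.rev hr) ?_ ?_ ?_ ?_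
  · intro ω hω
    simp only [setB2a, Finset.mem_filter, Finset.mem_univ, true_and] at hω
    exact ω.G_add_G_rev Θ hr hW hΘ hω
  · intro ω hω _
    simp only [setB2a, Finset.mem_filter, Finset.mem_univ, true_and] at hω
    exact ω.rev_ne hr hω
  · intro ω hω
    simp only [setB2a, Finset.mem_filter, Finset.mem_univ, true_and] at hω ⊢
    exact ω.rev_isB2a hr hω
  · intro ω hω
    simp only [setB2a, Finset.mem_filter, Finset.mem_univ, true_and] at hω
    exact ω.rev_rev hr hω

/-- **The vertex relation as a vanishing sum.** [cite: GlazmanManolescu2019, Lemma 2.1] -/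
theorem sum_g_eq_zero (hr : r ∈ rect T L) (hW : GlazmanManolescu2019_excursionWinding) (hΘ : ∀ k, Θ k ∈ Set.Icc (π / 3) (2 * π / 3)) :
    ∑ ω : Ω T L r, ω.g Θ = 0 := by
  rw [sum_split, add_assoc, sum_A_add_sum_B1 Θ hr hΘ, sum_B2a_add_sum_B2b Θ hr hW hΘ, add_zero]

end Ω

/-- **Lemma 2.1 from the local relations and the excursion windings.**
[cite: GlazmanManolescu2019, Lemma 2.1] -/
theorem GlazmanManolescu2019_lem21_of_excursionWinding (hW : GlazmanManolescu2019_excursionWinding) :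
    GlazmanManolescu2019_lem21 := by
  intro T L Θ hΘ r hr
  have key := Ω.sum_g_eq_zero (T := T) (L := L) (r := r) Θ hr hW hΘ
  rw [Fintype.sum_sigma] at key
  simp only [Ω.g] at key
  have hu : (Finset.univ : Finset Side) = {Side.W, Side.E, Side.S, Side.N} := by decide
  rw [hu, Finset.sum_insert (by decide), Finset.sum_insert (by decide), Finset.sum_insert (by decide),
    Finset.sum_singleton] at key
  simp only [← Finset.mul_sum] at key
  rw [← parafermion, ← parafermion, ← parafermion, ← parafermion] at key
  simp only [crCoef] at key
  linear_combination key

end CR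

end Literature.Probability.RandomPlanarGeometry.SAW.YangBaxter
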